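import Literature.NumberTheory.Sieve.BombieriAsymptoticSieveSigma0Comb
import Literature.NumberTheory.Sieve.BombieriAsymptoticSieveSigma0Sieve
import Literature.NumberTheory.Sieve.BombieriAsymptoticSieveDimension
import Literature.NumberTheory.Sieve.BombieriAsymptoticSieveProofs
import Literature.NumberTheory.Sieve.SieveFrameworkFundamentalLemma
import HarnessLib

/-!
# Bombieri's asymptotic sieve: the `Σ₀`-estimate via the smooth-part decomposition (a second proof of Lemma 10)

Topic `Literature/NumberTheory/Sieve`, companion ("Proofs") file of `BombieriAsymptoticSieve.lean`
([BombieriRIMS1977]; [FriedlanderIwaniecPisa1978]). The tree already contains a proof of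
[FriedlanderIwaniecPisa1978] Lemma 10 (`Literature.NumberTheory.Sieve.FI1978_lemma10_holds`, `BombieriAsymptoticSieveSigma0.lean`,
by dissection into bins and a beta-sieve upper bound) and hence of Bombieri's Theorem 1
(`Literature.NumberTheory.Sieve.bombieri1976_asymptotic_sieve_proved`, `BombieriAsymptoticSieveShiftedPrimesProofs.lean`, =
`Bombieri1976_asymptotic_sieve_of_lemma10 FI1978_lemma10_holds`). This file records an independent
route to the same end, closer to [FriedlanderIwaniecPisa1978] §6 (proof of Lemma 24): regroup
`Σ₀` by the `x^{1/(8k)}`-smooth part `q` of `n`, sift the cofactor with the fundamental lemma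
applied to the sequences `C_q = (a_{qr} 1_{(r,q)=1})_r`, sum the main terms by peeling the least
prime, and control the remainders through (A₂) and a representation count. It proves Lemma 10 in
the range `2 ≤ z ≤ x^{1/(8k)}` (`BombieriSieve.FI1978_lemma10_small`), which is the range used by
the proof of Theorem 1 (`z = x^{ε^{4/3}}`), and the corresponding assembly `BombieriSieve.core_small`
([FriedlanderIwaniecPisa1978] pp. 739–740 with the extra condition `u ≥ 8k`; an independent route,
kept deliberately: it shows that the small range of Lemma 10 suffices), from which Theorem 1
follows exactly as in `Bombieri1976_asymptotic_sieve_of_lemmas`. Theorem 1 itself is NOT restated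
here: its canonical discharge `Bombieri1976_asymptotic_sieve_holds` is the one-liner
`Bombieri1976_asymptotic_sieve_of_lemma10 FI1978_lemma10_holds` (`BombieriAsymptoticSieveTheorem1.lean`),
an alias of `bombieri1976_asymptotic_sieve_proved`. Uses only (A₁), (A₂), (A₅) and the
fundamental lemma (no (A₃), (A₄), (A₆)).

* `BombieriSieve.sum_smooth_weight_generalizedVonMangoldt_le` — the main terms
  `∑_{q} G(q) Λ_c(q) ≪ (log B)^{c−1} log z` (peeling; `BombieriAsymptoticSieveLeibniz.lean`);
* `BombieriSieve.sum_bad_le` — smooth parts `q > √x` (window lemma of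
  `BombieriAsymptoticSieveSigma0Comb.lean`, (A₁), (A₂));
* `BombieriSieve.squarefree_divisor_le`, `BombieriSieve.sum_good_remainders_le` — remainders of the
  sifted subsequences (moduli `qed < x^{3/4}`, multiplicity `(log x)^{O(k)}`, (A₂));
* `BombieriSieve.sum_good_le` — smooth parts `q ≤ √x`: the fundamental lemma for `C_q`
  (`BombieriAsymptoticSieveSigma0Sieve.lean`);
* `BombieriSieve.natLog_two_le`, `BombieriSieve.FI1978_lemma10_small` — the assembly (`θ = 1/(8k)`,
  `V(x^θ) ≪ 1/log x` by Lemma 7 gives the saving); one `set_option maxHeartbeats 1600000 in`;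
* `BombieriSieve.core_small` — pp. 739–740 with Lemma 10 in the small range.
-/

noncomputable section

namespace Literature.NumberTheory.Sieve

namespace BombieriSieve

open Finset ArithmeticFunction Filter
open scoped ArithmeticFunction.Moebius ArithmeticFunction.vonMangoldt Topology

/-! ### The smooth-number main term: `∑_{q ∈ Qset} G(q) Λ_c(q) ≪ (log B)^{c−1} log ⌈z⌉` -/

/-- **Main-term smooth sums.** For the weight `G(q) = ∑_{e ∣ q} |μ(e)| g(qe)` of a multiplicative
`g ≥ 0` whose prime-power sums satisfy `E_c(P) ≤ C_E (log P)^c` (`1 ≤ c ≤ k`, all `P ≥ 2`, all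
`X`) and whose smooth sums satisfy `∑_{m ≤ X, P-smooth} G(m)Λ_j(m) ≤ D (log P)^j` (`j ≤ k`):
for `2 ≤ Q ≤ B` and `1 ≤ c ≤ k`,
`∑_{q ≤ X, B-smooth, q ≠ 1, minFac q < Q} G(q) Λ_c(q) ≤ 2^c C_E D (log B)^{c−1} log Q`
(peel the least prime, which is `< Q`; `(log Q)^{c'+1} ≤ (log B)^{c'} log Q`). [folklore] -/
theorem sum_smooth_weight_generalizedVonMangoldt_le (g : ArithmeticFunction ℝ)
    (hg : g.IsMultiplicative) (hg0 : ∀ n, 0 ≤ g n) (k : ℕ) {CE D : ℝ} (hCE : 0 ≤ CE) (hD0 : 0 ≤ D)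
    (hE : ∀ (P X c : ℕ), 2 ≤ P → 1 ≤ c → c ≤ k →
      ∑ p ∈ Nat.primesBelow P, ∑ a ∈ Finset.Icc 1 (Nat.log 2 X),
        (g (p ^ a) + g (p ^ (a + 1))) * ((a : ℝ) * Real.log p) ^ c ≤ CE * Real.log P ^ c)
    (hD : ∀ P X : ℕ, 2 ≤ P → ∀ j, j ≤ k →
      ∑ m ∈ Nat.smoothNumbersUpTo X P, (∑ e ∈ m.divisors, |(μ e : ℝ)| * g (m * e)) *
        generalizedVonMangoldt j m ≤ D * Real.log P ^ j)
    {B Q X c : ℕ} (hQ : 2 ≤ Q) (hQB : Q ≤ B) (hc1 : 1 ≤ c) (hck : c ≤ k) :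
    ∑ q ∈ (Nat.smoothNumbersUpTo X B).filter (fun q : ℕ => q ≠ 1 ∧ Nat.minFac q < Q),
        (∑ e ∈ q.divisors, |(μ e : ℝ)| * g (q * e)) * generalizedVonMangoldt c q ≤
      2 ^ c * CE * D * Real.log B ^ (c - 1) * Real.log Q := by
  set G : ℕ → ℝ := fun q => ∑ e ∈ q.divisors, |(μ e : ℝ)| * g (q * e) with hG
  set W : ℕ → ℕ → ℝ := fun p a => g (p ^ a) + g (p ^ (a + 1)) with hW
  have hG0 : ∀ m, 0 ≤ G m := fun m =>
    Finset.sum_nonneg fun e _ => mul_nonneg (abs_nonneg _) (hg0 _)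
  have hW0 : ∀ p a, 0 ≤ W p a := fun p a => add_nonneg (hg0 _) (hg0 _)
  have hGmul : ∀ p a m : ℕ, p.Prime → 1 ≤ a → ¬ p ∣ m → G (p ^ a * m) ≤ W p a * G m :=
    fun p a m hp ha hpm => le_of_eq (sumAbsMoebius_primePow_mul g hg hp ha hpm)
  have hB2 : 2 ≤ B := hQ.trans hQB
  have hlogQ0 : 0 ≤ Real.log Q := Real.log_natCast_nonneg Q
  have hlogB0 : 0 ≤ Real.log B := Real.log_natCast_nonneg B
  have hlogQB : Real.log Q ≤ Real.log B :=
    Real.log_le_log (by exact_mod_cast (show 0 < Q by omega)) (by exact_mod_cast hQB)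
  refine (sum_smooth_mul_generalizedVonMangoldt_le hG0 hW0 hGmul B X c Q).trans ?_
  -- bound each peeled term
  have hterm : ∀ c' ∈ Finset.range c, (c.choose (c' + 1) : ℝ) *
      ((∑ p ∈ Nat.primesBelow Q, ∑ a ∈ Finset.Icc 1 (Nat.log 2 X),
          W p a * ((a : ℝ) * Real.log p) ^ (c' + 1)) *
        ∑ m ∈ Nat.smoothNumbersUpTo X B, G m * generalizedVonMangoldt (c - (c' + 1)) m) ≤
      (c.choose (c' + 1) : ℝ) * (CE * D * Real.log B ^ (c - 1) * Real.log Q) := by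
    intro c' hc'
    have hc'c : c' < c := Finset.mem_range.mp hc'
    refine mul_le_mul_of_nonneg_left ?_ (Nat.cast_nonneg _)
    have h1 := hE Q X (c' + 1) hQ (by omega) (by omega)
    have h2 := hD B X hB2 (c - (c' + 1)) (by omega)
    have h1' : 0 ≤ ∑ p ∈ Nat.primesBelow Q, ∑ a ∈ Finset.Icc 1 (Nat.log 2 X),
        W p a * ((a : ℝ) * Real.log p) ^ (c' + 1) :=
      Finset.sum_nonneg fun p _ => Finset.sum_nonneg fun a _ => mul_nonneg (hW0 p a)
        (pow_nonneg (mul_nonneg (Nat.cast_nonneg _) (Real.log_natCast_nonneg _)) _)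
    have h2' : 0 ≤ ∑ m ∈ Nat.smoothNumbersUpTo X B, G m * generalizedVonMangoldt (c - (c' + 1)) m :=
      Finset.sum_nonneg fun m _ => mul_nonneg (hG0 m) (generalizedVonMangoldt_nonneg _ _)
    have hQpow : Real.log Q ^ (c' + 1) ≤ Real.log B ^ c' * Real.log Q := by
      rw [pow_succ]
      exact mul_le_mul_of_nonneg_right (pow_le_pow_left₀ hlogQ0 hlogQB c') hlogQ0
    calc (∑ p ∈ Nat.primesBelow Q, ∑ a ∈ Finset.Icc 1 (Nat.log 2 X),
            W p a * ((a : ℝ) * Real.log p) ^ (c' + 1)) *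
          ∑ m ∈ Nat.smoothNumbersUpTo X B, G m * generalizedVonMangoldt (c - (c' + 1)) m
        ≤ (CE * Real.log Q ^ (c' + 1)) * (D * Real.log B ^ (c - (c' + 1))) :=
          mul_le_mul h1 h2 h2' (mul_nonneg hCE (pow_nonneg hlogQ0 _))
      _ ≤ (CE * (Real.log B ^ c' * Real.log Q)) * (D * Real.log B ^ (c - (c' + 1))) :=
          mul_le_mul_of_nonneg_right (mul_le_mul_of_nonneg_left hQpow hCE)
            (mul_nonneg hD0 (pow_nonneg hlogB0 _))
      _ = CE * D * (Real.log B ^ c' * Real.log B ^ (c - (c' + 1))) * Real.log Q := by ring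
      _ = CE * D * Real.log B ^ (c - 1) * Real.log Q := by
          rw [← pow_add, show c' + (c - (c' + 1)) = c - 1 from by omega]
  refine (Finset.sum_le_sum hterm).trans ?_
  rw [← Finset.sum_mul]
  have hchoose : ∑ c' ∈ Finset.range c, (c.choose (c' + 1) : ℝ) ≤ 2 ^ c := by
    have h := Nat.sum_range_choose c
    have h' : ∑ c' ∈ Finset.range c, c.choose (c' + 1) ≤ 2 ^ c := by
      rw [← h, Finset.sum_range_succ' (fun i => c.choose i)]
      exact Nat.le_add_right _ _
    exact_mod_cast h'
  have hrest : 0 ≤ CE * D * Real.log B ^ (c - 1) * Real.log Q :=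
    mul_nonneg (mul_nonneg (mul_nonneg hCE hD0) (pow_nonneg hlogB0 _)) hlogQ0
  calc (∑ c' ∈ Finset.range c, (c.choose (c' + 1) : ℝ)) * (CE * D * Real.log B ^ (c - 1) * Real.log Q)
      ≤ 2 ^ c * (CE * D * Real.log B ^ (c - 1) * Real.log Q) := mul_le_mul_of_nonneg_right hchoose hrest
    _ = 2 ^ c * CE * D * Real.log B ^ (c - 1) * Real.log Q := by ring

end BombieriSieve

end Literature.NumberTheory.Sieve

namespace Literature.NumberTheory.Sieve

namespace BombieriSieve

open Finset ArithmeticFunction Filter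
open scoped ArithmeticFunction.Moebius ArithmeticFunction.vonMangoldt Topology

/-! ### The bad part: `q > √x` -/

/-- **The bad smooth parts contribute `≪ (log x)^c (A(x) #W C₁ x^{−3θ/2} + ∑_W |R(x; p^b)|)`**
(`W` the window of `sum_bad_smoothPart_le`, `θ = 1/(8k)`): for `q > √x` with `ω(q) ≤ k` we use
`Λ_c(q) ≤ (log x)^c`, the union bound, `A(x; p^b) = g(p^b)A(x) + R(x; p^b)` and
`g(p^b) ≤ C₁ (p^b)^{−3/4} ≤ C₁ x^{−3θ/2}` on the window. [folklore] -/
theorem sum_bad_le (A : SieveSequence) {C₁ : ℝ} (hC₁0 : 0 ≤ C₁)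
    (hC₁ : ∀ d : ℕ, 1 ≤ d → A.density d ≤ C₁ * ((d : ℝ) ^ (3 / 4 : ℝ))⁻¹)
    {k : ℕ} (hk : 1 ≤ k) {x : ℝ} (hx : 1 < x) (hA0 : 0 ≤ A.size x) (c : ℕ) (Qset : Finset ℕ)
    (hQ : ∀ q ∈ Qset, q ≤ ⌊x⌋₊) :
    ∑ q ∈ Qset.filter (fun q : ℕ => (smoothPart ⌈x ^ ((8 * k : ℝ)⁻¹)⌉₊ q).primeFactors.card ≤ k ∧
        Real.sqrt x < q ∧ smoothPart ⌈x ^ ((8 * k : ℝ)⁻¹)⌉₊ q = q),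
      generalizedVonMangoldt c q *
        ∑ n ∈ (Ioc 0 ⌊x⌋₊).filter (fun n : ℕ => smoothPart ⌈x ^ ((8 * k : ℝ)⁻¹)⌉₊ n = q), A.a n ≤
      Real.log x ^ c *
        (A.size x * ((((Nat.primesBelow ⌈x ^ ((8 * k : ℝ)⁻¹)⌉₊) ×ˢ
            Finset.Icc 2 (Nat.log 2 ⌊x⌋₊)).card : ℝ) * (C₁ * (x ^ (3 / 2 * (8 * k : ℝ)⁻¹))⁻¹)) +
          ∑ d ∈ Finset.Ico 1 ⌈x ^ (1 - 1 / 2 : ℝ)⌉₊, |A.remainder d x|) := by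
  set θ : ℝ := (8 * k : ℝ)⁻¹ with hθ
  set B := ⌈x ^ θ⌉₊ with hB
  set N := ⌊x⌋₊ with hN
  set L := Real.log x with hL
  have hx0 : 0 < x := by linarith
  have hL0 : 0 ≤ L := Real.log_nonneg hx.le
  have hk0 : (0 : ℝ) < k := by exact_mod_cast hk
  have hθ0 : 0 < θ := by rw [hθ]; positivity
  set Qbad := Qset.filter (fun q : ℕ => (smoothPart B q).primeFactors.card ≤ k ∧
    Real.sqrt x < q ∧ smoothPart B q = q) with hQbad
  set M : ℕ → ℝ := fun q => ∑ n ∈ (Ioc 0 N).filter (fun n : ℕ => smoothPart B n = q), A.a n with hM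
  have hM0 : ∀ q, 0 ≤ M q := fun q => Finset.sum_nonneg fun n _ => A.a_nonneg n
  -- `Λ_c(q) ≤ L^c` for `q ≤ N ≤ x`
  have hstep1 : ∑ q ∈ Qbad, generalizedVonMangoldt c q * M q ≤ L ^ c * ∑ q ∈ Qbad, M q := by
    rw [Finset.mul_sum]
    refine Finset.sum_le_sum fun q hq => mul_le_mul_of_nonneg_right ?_ (hM0 q)
    obtain ⟨hq', -, hbig, -⟩ := Finset.mem_filter.mp hq
    have hq1 : 1 ≤ q := by
      have : (0 : ℝ) < q := (Real.sqrt_nonneg x).trans_lt hbig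
      exact_mod_cast this
    exact generalizedVonMangoldt_le_pow_log hq1
      ((Nat.cast_le.mpr (hQ q hq')).trans (Nat.floor_le hx0.le))
  -- `∑_{q ∈ Qbad} M q ≤` mass of `{n : ω(sm n) ≤ k, √x < sm n}`
  have hstep2 : ∑ q ∈ Qbad, M q ≤ ∑ n ∈ (Ioc 0 N).filter (fun n : ℕ =>
      (smoothPart B n).primeFactors.card ≤ k ∧ Real.sqrt x < smoothPart B n), A.a n := by
    have hfib : ∑ q ∈ Qbad, M q =
        ∑ n ∈ (Ioc 0 N).filter (fun n : ℕ => smoothPart B n ∈ Qbad), A.a n := by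
      rw [hM]
      simp only
      rw [← Finset.sum_fiberwise_of_maps_to (g := fun n : ℕ => smoothPart B n) (t := Qbad)
        (s := (Ioc 0 N).filter (fun n : ℕ => smoothPart B n ∈ Qbad)) (f := A.a)
        (fun n hn => (Finset.mem_filter.mp hn).2)]
      refine Finset.sum_congr rfl fun q hq => ?_
      congr 1
      ext n
      simp only [Finset.mem_filter]
      constructor
      · rintro ⟨hn, rfl⟩; exact ⟨⟨hn, hq⟩, rfl⟩
      · rintro ⟨⟨hn, -⟩, h⟩; exact ⟨hn, h⟩
    rw [hfib]
    refine Finset.sum_le_sum_of_subset_of_nonneg (fun n hn => ?_) fun n _ _ => A.a_nonneg n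
    obtain ⟨hn, hq⟩ := Finset.mem_filter.mp hn
    obtain ⟨-, hω, hbig, hsm⟩ := Finset.mem_filter.mp hq
    rw [hsm] at hω
    refine Finset.mem_filter.mpr ⟨hn, hω, ?_⟩
    exact_mod_cast hbig
  -- union bound and `A(x; p^b) = g(p^b) A + R`
  have hstep3 := sum_bad_smoothPart_le A hk hx
  set W := ((Nat.primesBelow B) ×ˢ Finset.Icc 2 (Nat.log 2 N)).filter
      (fun w : ℕ × ℕ => x ^ (2 * θ) ≤ (w.1 : ℝ) ^ w.2 ∧ (w.1 : ℝ) ^ w.2 < x ^ (3 * θ)) with hW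
  have hstep4 : ∑ w ∈ W, A.congrSum (w.1 ^ w.2) x ≤
      A.size x * ((((Nat.primesBelow B) ×ˢ Finset.Icc 2 (Nat.log 2 N)).card : ℝ) *
          (C₁ * (x ^ (3 / 2 * θ))⁻¹)) +
        ∑ d ∈ Finset.Ico 1 ⌈x ^ (1 - 1 / 2 : ℝ)⌉₊, |A.remainder d x| := by
    have hsplit : ∀ w ∈ W, A.congrSum (w.1 ^ w.2) x =
        A.density (w.1 ^ w.2) * A.size x + A.remainder (w.1 ^ w.2) x := fun w _ => by
      rw [SieveSequence.remainder]; ring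
    rw [Finset.sum_congr rfl hsplit, Finset.sum_add_distrib]
    refine add_le_add ?_ ?_
    · -- densities on the window
      have hfac0 : 0 ≤ C₁ * (x ^ (3 / 2 * θ))⁻¹ * A.size x :=
        mul_nonneg (mul_nonneg hC₁0 (inv_nonneg.mpr (Real.rpow_nonneg hx0.le _))) hA0
      have hgw : ∀ w ∈ W, A.density (w.1 ^ w.2) * A.size x ≤ C₁ * (x ^ (3 / 2 * θ))⁻¹ * A.size x := by
        intro w hw
        obtain ⟨hw', hlo, -⟩ := Finset.mem_filter.mp hw
        obtain ⟨hp, -⟩ := Finset.mem_product.mp hw'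
        have hpp := Nat.prime_of_mem_primesBelow hp
        refine mul_le_mul_of_nonneg_right ?_ hA0
        refine (hC₁ (w.1 ^ w.2) (Nat.one_le_pow _ _ hpp.pos)).trans
          (mul_le_mul_of_nonneg_left ?_ hC₁0)
        have hx2θ : 0 < x ^ (2 * θ) := Real.rpow_pos_of_pos hx0 _
        refine inv_anti₀ (Real.rpow_pos_of_pos hx0 _) ?_
        calc x ^ (3 / 2 * θ) = (x ^ (2 * θ)) ^ (3 / 4 : ℝ) := by
              rw [← Real.rpow_mul hx0.le]; ring_nf
          _ ≤ (((w.1 ^ w.2 : ℕ) : ℝ)) ^ (3 / 4 : ℝ) := by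
              rw [Nat.cast_pow]
              exact Real.rpow_le_rpow hx2θ.le hlo (by norm_num)
      calc ∑ w ∈ W, A.density (w.1 ^ w.2) * A.size x
          ≤ ∑ _w ∈ W, C₁ * (x ^ (3 / 2 * θ))⁻¹ * A.size x := Finset.sum_le_sum hgw
        _ = (W.card : ℝ) * (C₁ * (x ^ (3 / 2 * θ))⁻¹ * A.size x) := by
            rw [Finset.sum_const, nsmul_eq_mul]
        _ ≤ ((((Nat.primesBelow B) ×ˢ Finset.Icc 2 (Nat.log 2 N)).card : ℕ) : ℝ) *
              (C₁ * (x ^ (3 / 2 * θ))⁻¹ * A.size x) := by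
            have hcard : W.card ≤ ((Nat.primesBelow B) ×ˢ Finset.Icc 2 (Nat.log 2 N)).card := by
              rw [hW]; exact Finset.card_filter_le _ _
            gcongr
        _ = A.size x * ((((Nat.primesBelow B) ×ˢ Finset.Icc 2 (Nat.log 2 N)).card : ℝ) *
              (C₁ * (x ^ (3 / 2 * θ))⁻¹)) := by ring
    · -- remainders on the window: distinct moduli `p^b < x^{3θ} ≤ x^{1/2}`
      have h3θ : 3 * θ ≤ 1 - 1 / 2 := by
        rw [hθ]
        have hk1 : (1 : ℝ) ≤ k := by exact_mod_cast hk
        rw [show (3 : ℝ) * (8 * (k : ℝ))⁻¹ = 3 / (8 * (k : ℝ)) by ring, div_le_iff₀ (by positivity)]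
        nlinarith
      have hinj : Set.InjOn (fun w : ℕ × ℕ => w.1 ^ w.2) ↑W := by
        rintro ⟨p, b⟩ hw ⟨p', b'⟩ hw' h
        simp only [Finset.coe_filter, Set.mem_setOf_eq, hW, Finset.mem_product, Nat.mem_primesBelow,
          Finset.mem_Icc] at hw hw'
        have hp : p.Prime := hw.1.1.2
        have hp' : p'.Prime := hw'.1.1.2
        have hb : 2 ≤ b := hw.1.2.1
        change p ^ b = p' ^ b' at h
        have hpp' : p = p' := by
          have h1 : p ∣ p' ^ b' := h ▸ dvd_pow_self p (by omega)
          exact (Nat.prime_dvd_prime_iff_eq hp hp').mp (hp.dvd_of_dvd_pow h1)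
        subst hpp'
        have hbb : b = b' := Nat.pow_right_injective hp.two_le h
        rw [hbb]
      have himage : W.image (fun w : ℕ × ℕ => w.1 ^ w.2) ⊆ Finset.Ico 1 ⌈x ^ (1 - 1 / 2 : ℝ)⌉₊ := by
        intro m hm
        obtain ⟨w, hw, rfl⟩ := Finset.mem_image.mp hm
        obtain ⟨hw', -, hhi⟩ := Finset.mem_filter.mp hw
        obtain ⟨hp, -⟩ := Finset.mem_product.mp hw'
        have hpp := Nat.prime_of_mem_primesBelow hp
        rw [Finset.mem_Ico]
        refine ⟨Nat.one_le_pow _ _ hpp.pos, Nat.lt_ceil.mpr ?_⟩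
        push_cast
        exact hhi.trans_le (Real.rpow_le_rpow_of_exponent_le hx.le h3θ)
      calc ∑ w ∈ W, A.remainder (w.1 ^ w.2) x ≤ ∑ w ∈ W, |A.remainder (w.1 ^ w.2) x| :=
            Finset.sum_le_sum fun w _ => le_abs_self _
        _ = ∑ m ∈ W.image (fun w : ℕ × ℕ => w.1 ^ w.2), |A.remainder m x| :=
            (Finset.sum_image (f := fun m => |A.remainder m x|) hinj).symm
        _ ≤ ∑ d ∈ Finset.Ico 1 ⌈x ^ (1 - 1 / 2 : ℝ)⌉₊, |A.remainder d x| :=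
            Finset.sum_le_sum_of_subset_of_nonneg himage fun d _ _ => abs_nonneg _
  -- assemble
  calc ∑ q ∈ Qbad, generalizedVonMangoldt c q * M q ≤ L ^ c * ∑ q ∈ Qbad, M q := hstep1
    _ ≤ L ^ c * (A.size x * ((((Nat.primesBelow B) ×ˢ Finset.Icc 2 (Nat.log 2 N)).card : ℝ) *
          (C₁ * (x ^ (3 / 2 * θ))⁻¹)) + ∑ d ∈ Finset.Ico 1 ⌈x ^ (1 - 1 / 2 : ℝ)⌉₊, |A.remainder d x|) :=
        mul_le_mul_of_nonneg_left (hstep2.trans (hstep3.trans hstep4)) (pow_nonneg hL0 _)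

end BombieriSieve

end Literature.NumberTheory.Sieve

namespace Literature.NumberTheory.Sieve

namespace BombieriSieve

open Finset ArithmeticFunction Filter
open scoped ArithmeticFunction.Moebius ArithmeticFunction.vonMangoldt Topology

/-! ### The good part: `q ≤ √x` -/

/-- A squarefree divisor of a `B`-smooth `q` with `ω(q) ≤ k` is `≤ (x^θ)^k` when `B = ⌈x^θ⌉₊`
(`e = ∏` its primes `∣ ∏_{p ∣ q} p ≤ (x^θ)^{ω(q)}`). [folklore] -/
theorem squarefree_divisor_le {q e k : ℕ} {x θ : ℝ} (hx : 1 ≤ x) (hθ : 0 ≤ θ)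
    (hq : q ∈ Nat.smoothNumbers ⌈x ^ θ⌉₊) (hω : q.primeFactors.card ≤ k) (he : Squarefree e)
    (heq : e ∣ q) : (e : ℝ) ≤ (x ^ θ) ^ k := by
  have hq0 : q ≠ 0 := Nat.ne_zero_of_mem_smoothNumbers hq
  have he0 : e ≠ 0 := he.ne_zero
  have hrad : e ∣ ∏ p ∈ q.primeFactors, p := by
    rw [← Nat.prod_primeFactors_of_squarefree he]
    exact Finset.prod_dvd_prod_of_subset _ _ _ (Nat.primeFactors_mono heq hq0)
  have hprod0 : 0 < ∏ p ∈ q.primeFactors, p :=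
    Finset.prod_pos fun p hp => (Nat.prime_of_mem_primeFactors hp).pos
  have hxθ1 : 1 ≤ x ^ θ := Real.one_le_rpow hx hθ
  calc (e : ℝ) ≤ ((∏ p ∈ q.primeFactors, p : ℕ) : ℝ) := by exact_mod_cast Nat.le_of_dvd hprod0 hrad
    _ = ∏ p ∈ q.primeFactors, (p : ℝ) := by push_cast; rfl
    _ ≤ ∏ _p ∈ q.primeFactors, x ^ θ := by
        refine Finset.prod_le_prod (fun p _ => Nat.cast_nonneg p) fun p hp => ?_
        exact (Nat.lt_ceil.mp ((Nat.mem_smoothNumbers'.mp hq) p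
          (Nat.prime_of_mem_primeFactors hp) (Nat.dvd_of_mem_primeFactors hp))).le
    _ = (x ^ θ) ^ q.primeFactors.card := Finset.prod_const _
    _ ≤ (x ^ θ) ^ k := pow_le_pow_right₀ hxθ1 hω

/-- **The remainders of the good subsequences** (`q ≤ √x`, `ω(q) ≤ k`, `k ≥ 2`, `θ = 1/(8k)`): the
moduli `q e d` (`e ∣ q` squarefree, `d ≤ x^θ` coprime to `q`) are `< x^{3/4}` and represent each
`m` at most `((log₂ x + 1)^k)²` times (`sum_triples_le`), so
`∑_{q good} ∑_d ∑_{e ∣ q} |μ(e)| |R(x; qed)| ≤ ((log₂ ⌈x^{3/4}⌉ + 1)^k)² ∑_{m < x^{3/4}} |R(x; m)|`.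
[folklore] -/
theorem sum_good_remainders_le (A : SieveSequence) {k : ℕ} (hk : 2 ≤ k) {x : ℝ} (hx : 1 < x)
    (Qgood : Finset ℕ)
    (hQ : ∀ q ∈ Qgood, q.primeFactors.card ≤ k ∧ (q : ℝ) ≤ Real.sqrt x ∧
      q ∈ Nat.smoothNumbers ⌈x ^ ((8 * k : ℝ)⁻¹)⌉₊) :
    ∑ q ∈ Qgood, ∑ d ∈ (primesProdBelow (x ^ ((8 * k : ℝ)⁻¹))).divisors.filter
        (fun d : ℕ => (d : ℝ) ≤ x ^ ((8 * k : ℝ)⁻¹) ∧ d.Coprime q),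
        ∑ e ∈ q.divisors, |(μ e : ℝ)| * |A.remainder (q * e * d) x| ≤
      ((((Nat.log 2 ⌈x ^ (1 - 1 / 4 : ℝ)⌉₊ + 1) ^ k) ^ 2 : ℕ) : ℝ) *
        ∑ m ∈ Finset.Ico 1 ⌈x ^ (1 - 1 / 4 : ℝ)⌉₊, |A.remainder m x| := by
  set θ : ℝ := (8 * k : ℝ)⁻¹ with hθ
  set P := primesProdBelow (x ^ θ) with hP
  set X := ⌈x ^ (1 - 1 / 4 : ℝ)⌉₊ with hX
  have hx0 : 0 < x := by linarith
  have hk0 : (0 : ℝ) < k := by exact_mod_cast (show 0 < k by omega)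
  have hθ0 : 0 < θ := by rw [hθ]; positivity
  have hθ16 : θ ≤ 1 / 16 := by
    rw [hθ]
    have hk2 : (2 : ℝ) ≤ k := by exact_mod_cast hk
    rw [inv_le_comm₀ (by positivity) (by norm_num)]
    norm_num
    linarith
  have hθk : θ * k = 1 / 8 := by rw [hθ]; field_simp
  set Dset : ℕ → Finset ℕ := fun q => P.divisors.filter (fun d : ℕ => (d : ℝ) ≤ x ^ θ ∧ d.Coprime q)
    with hDset
  set Eset : ℕ → Finset ℕ := fun q => q.divisors.filter Squarefree with hEset
  -- Step 1: drop `|μ|`, keep squarefree `e`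
  have h1 : ∀ q ∈ Qgood, ∀ d ∈ Dset q, ∑ e ∈ q.divisors, |(μ e : ℝ)| * |A.remainder (q * e * d) x| ≤
      ∑ e ∈ Eset q, |A.remainder (q * e * d) x| := by
    intro q _ d _
    rw [hEset, Finset.sum_filter]
    refine Finset.sum_le_sum fun e _ => ?_
    by_cases hsq : Squarefree e
    · rw [if_pos hsq]
      have hμ : |(μ e : ℝ)| ≤ 1 := by
        rw [← Int.cast_abs]; exact_mod_cast ArithmeticFunction.abs_moebius_le_one
      exact (mul_le_mul_of_nonneg_right hμ (abs_nonneg _)).trans (one_mul _).le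
    · rw [if_neg hsq, ArithmeticFunction.moebius_eq_zero_of_not_squarefree hsq]
      simp
  -- Step 2: the triple sum as a sum over triples
  set T : Finset ((_ : ℕ) × (ℕ × ℕ)) := Qgood.sigma (fun q => Dset q ×ˢ Eset q) with hT
  have h2 : ∑ q ∈ Qgood, ∑ d ∈ Dset q, ∑ e ∈ Eset q, |A.remainder (q * e * d) x| =
      ∑ t ∈ T, |A.remainder (t.1 * t.2.2 * t.2.1) x| := by
    have h3 : ∀ q ∈ Qgood, ∑ d ∈ Dset q, ∑ e ∈ Eset q, |A.remainder (q * e * d) x| =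
        ∑ de ∈ Dset q ×ˢ Eset q, |A.remainder (q * de.2 * de.1) x| := fun q _ =>
      (Finset.sum_product' (Dset q) (Eset q) (fun d e => |A.remainder (q * e * d) x|)).symm
    rw [Finset.sum_congr rfl h3, hT]
    exact Finset.sum_sigma' Qgood (fun q => Dset q ×ˢ Eset q)
      (fun q de => |A.remainder (q * de.2 * de.1) x|)
  -- Step 3: the hypotheses of `sum_triples_le`
  have hT' : ∀ t ∈ T, Squarefree t.2.2 ∧ t.2.2 ∣ t.1 ∧ t.2.1.Coprime t.1 ∧
      t.1.primeFactors.card ≤ k ∧ 1 ≤ t.1 * t.2.2 * t.2.1 ∧ t.1 * t.2.2 * t.2.1 < X := by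
    intro t ht
    rw [hT, Finset.mem_sigma, Finset.mem_product] at ht
    obtain ⟨hq, hd, he⟩ := ht
    obtain ⟨hω, hqx, hsm⟩ := hQ _ hq
    obtain ⟨hd', hdx, hdq⟩ := Finset.mem_filter.mp hd
    obtain ⟨he', hsq⟩ := Finset.mem_filter.mp he
    have hq0 : t.1 ≠ 0 := Nat.ne_zero_of_mem_smoothNumbers hsm
    have hdP : t.2.1 ∣ P := Nat.dvd_of_mem_divisors hd'
    have hd0 : t.2.1 ≠ 0 := fun h => primesProdBelow_ne_zero (x ^ θ)
      (Nat.eq_zero_of_zero_dvd (h ▸ hdP))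
    have heq : t.2.2 ∣ t.1 := Nat.dvd_of_mem_divisors he'
    have he0 : t.2.2 ≠ 0 := hsq.ne_zero
    refine ⟨hsq, heq, hdq, hω, Nat.one_le_iff_ne_zero.mpr
      (Nat.mul_ne_zero (Nat.mul_ne_zero hq0 he0) hd0), Nat.lt_ceil.mpr ?_⟩
    -- `q e d ≤ x^{1/2} · x^{1/8} · x^θ < x^{3/4}`
    have hex : (t.2.2 : ℝ) ≤ (x ^ θ) ^ k := squarefree_divisor_le hx.le hθ0.le hsm hω hsq heq
    have h18 : (x ^ θ) ^ k = x ^ (1 / 8 : ℝ) := by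
      rw [← Real.rpow_natCast, ← Real.rpow_mul hx0.le, hθk]
    rw [h18] at hex
    have hsqrt : Real.sqrt x = x ^ (1 / 2 : ℝ) := Real.sqrt_eq_rpow x
    push_cast
    calc (t.1 : ℝ) * t.2.2 * t.2.1 ≤ x ^ (1 / 2 : ℝ) * x ^ (1 / 8 : ℝ) * x ^ θ := by
          rw [← hsqrt]
          exact mul_le_mul (mul_le_mul hqx hex (Nat.cast_nonneg _) (Real.sqrt_nonneg x)) hdx
            (Nat.cast_nonneg _) (mul_nonneg (Real.sqrt_nonneg x) (Real.rpow_nonneg hx0.le _))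
      _ = x ^ (1 / 2 + 1 / 8 + θ) := by
          rw [← Real.rpow_add hx0, ← Real.rpow_add hx0]
      _ < x ^ (1 - 1 / 4 : ℝ) := Real.rpow_lt_rpow_of_exponent_lt hx (by linarith)
  calc ∑ q ∈ Qgood, ∑ d ∈ Dset q, ∑ e ∈ q.divisors, |(μ e : ℝ)| * |A.remainder (q * e * d) x|
      ≤ ∑ q ∈ Qgood, ∑ d ∈ Dset q, ∑ e ∈ Eset q, |A.remainder (q * e * d) x| :=
        Finset.sum_le_sum fun q hq => Finset.sum_le_sum fun d hd => h1 q hq d hd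
    _ = ∑ t ∈ T, |A.remainder (t.1 * t.2.2 * t.2.1) x| := h2
    _ ≤ _ := sum_triples_le (fun m => |A.remainder m x|) (fun m => abs_nonneg _) hT'

end BombieriSieve

end Literature.NumberTheory.Sieve

namespace Literature.NumberTheory.Sieve

namespace BombieriSieve

open Finset ArithmeticFunction Filter
open scoped ArithmeticFunction.Moebius ArithmeticFunction.vonMangoldt Topology

/-- **The good smooth parts, main reduction** (`q ≤ √x`, `ω(q) ≤ k`): with `B = ⌈x^θ⌉₊`,
`θ = 1/(8k)`, `M(q) = ∑_{n ≤ x, smoothPart B n = q} a_n ≤ S(C_q, x^θ)` (`sum_smoothPart_eq_le`) and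
the fundamental lemma for `C_q` (`sifted_subsequence_le`), `g♭(q) ≤ G(q)`, `Λ_c(q) ≤ (log x)^c`:
`∑_{q good} Λ_c(q) M(q) ≤ (1 + C_F)(2K)^k V(x^θ) A(x) ∑_{q ∈ Qset} G(q)Λ_c(q) + (log x)^c ∑_{q good} RR(q)`.
[cite: FriedlanderIwaniecPisa1978, Lemma 24 (proof, S₂ via Lemma 19)] -/
theorem sum_good_le {K CF : ℝ}
    (hFL' : ∀ A : SieveSequence, HasSieveDimension A.density 1 K → ∀ x z D : ℝ, 2 ≤ z → z ≤ D →
      0 ≤ A.size x →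
        |A.sifted x (primesProdBelow z) - A.size x * A.densityProduct (primesProdBelow z)| ≤
          CF * A.size x * A.densityProduct (primesProdBelow z) *
              Real.exp (-(Real.log D / Real.log z)) +
            ∑ d ∈ (primesProdBelow z).divisors.filter (fun d : ℕ => (d : ℝ) ≤ D),
              |A.remainder d x|)
    (hCF : 0 ≤ CF) (A : SieveSequence) (hK : HasSieveDimension A.density 1 K)
    (hg0 : ∀ d, 1 ≤ d → 0 ≤ A.density d)
    (hflat : ∀ q : ℕ, q ≠ 0 → 0 ≤ ∑ e ∈ q.divisors, (μ e : ℝ) * A.density (q * e))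
    {k : ℕ} {x : ℝ} (hx : 1 < x) (hxθ : 2 ≤ x ^ ((8 * k : ℝ)⁻¹)) (hA0 : 0 ≤ A.size x) (c : ℕ)
    (Qset : Finset ℕ) (hQset : ∀ q ∈ Qset, q ≠ 0 ∧ q ≤ ⌊x⌋₊) :
    ∑ q ∈ Qset.filter (fun q : ℕ => q.primeFactors.card ≤ k ∧ (q : ℝ) ≤ Real.sqrt x),
        generalizedVonMangoldt c q *
          ∑ n ∈ (Ioc 0 ⌊x⌋₊).filter (fun n : ℕ => smoothPart ⌈x ^ ((8 * k : ℝ)⁻¹)⌉₊ n = q), A.a n ≤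
      (1 + CF) * (2 * K) ^ k * A.densityProduct (primesProdBelow (x ^ ((8 * k : ℝ)⁻¹))) *
          A.size x *
          ∑ q ∈ Qset, (∑ e ∈ q.divisors, |(μ e : ℝ)| * A.density (q * e)) *
            generalizedVonMangoldt c q +
        Real.log x ^ c *
          ∑ q ∈ Qset.filter (fun q : ℕ => q.primeFactors.card ≤ k ∧ (q : ℝ) ≤ Real.sqrt x),
            ∑ d ∈ (primesProdBelow (x ^ ((8 * k : ℝ)⁻¹))).divisors.filter
              (fun d : ℕ => (d : ℝ) ≤ x ^ ((8 * k : ℝ)⁻¹) ∧ d.Coprime q),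
              ∑ e ∈ q.divisors, |(μ e : ℝ)| * |A.remainder (q * e * d) x| := by
  set θ : ℝ := (8 * k : ℝ)⁻¹ with hθ
  set ζ := x ^ θ with hζ
  set V := A.densityProduct (primesProdBelow ζ) with hV
  set L := Real.log x with hL
  set Qgood := Qset.filter (fun q : ℕ => q.primeFactors.card ≤ k ∧ (q : ℝ) ≤ Real.sqrt x) with hQg
  set G : ℕ → ℝ := fun q => ∑ e ∈ q.divisors, |(μ e : ℝ)| * A.density (q * e) with hG
  set RR : ℕ → ℝ := fun q => ∑ d ∈ (primesProdBelow ζ).divisors.filter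
      (fun d : ℕ => (d : ℝ) ≤ ζ ∧ d.Coprime q), ∑ e ∈ q.divisors, |(μ e : ℝ)| * |A.remainder (q * e * d) x|
    with hRR
  have hx0 : 0 < x := by linarith
  have hL0 : 0 ≤ L := Real.log_nonneg hx.le
  have hK1 : 1 ≤ K := hK.one_le
  have hV0 : 0 ≤ V := by
    rw [hV, SieveSequence.densityProduct, primeFactors_primesProdBelow]
    exact Finset.prod_nonneg fun p hp =>
      sub_nonneg.mpr (hK.1 p (Nat.prime_of_mem_primesBelow hp)).2.le
  have hfac0 : 0 ≤ (1 + CF) * (2 * K) ^ k * V * A.size x :=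
    mul_nonneg (mul_nonneg (mul_nonneg (by linarith) (by positivity)) hV0) hA0
  have hRR0 : ∀ q, 0 ≤ RR q := fun q => Finset.sum_nonneg fun d _ =>
    Finset.sum_nonneg fun e _ => mul_nonneg (abs_nonneg _) (abs_nonneg _)
  have hGΛ0 : ∀ q ∈ Qset, 0 ≤ G q * generalizedVonMangoldt c q := by
    intro q hq
    refine mul_nonneg (Finset.sum_nonneg fun e he => mul_nonneg (abs_nonneg _) (hg0 _ ?_))
      (generalizedVonMangoldt_nonneg _ _)
    exact Nat.one_le_iff_ne_zero.mpr (Nat.mul_ne_zero (hQset q hq).1 (Nat.pos_of_mem_divisors he).ne')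
  -- per `q`
  have hper : ∀ q ∈ Qgood, generalizedVonMangoldt c q *
      ∑ n ∈ (Ioc 0 ⌊x⌋₊).filter (fun n : ℕ => smoothPart ⌈ζ⌉₊ n = q), A.a n ≤
      (1 + CF) * (2 * K) ^ k * V * A.size x * (G q * generalizedVonMangoldt c q) + L ^ c * RR q := by
    intro q hq
    obtain ⟨hq', hω, hqx⟩ := Finset.mem_filter.mp hq
    obtain ⟨hq0, hqN⟩ := hQset q hq'
    have hΛ0 : 0 ≤ generalizedVonMangoldt c q := generalizedVonMangoldt_nonneg _ _
    have hΛL : generalizedVonMangoldt c q ≤ L ^ c :=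
      generalizedVonMangoldt_le_pow_log (Nat.one_le_iff_ne_zero.mpr hq0)
        ((Nat.cast_le.mpr hqN).trans (Nat.floor_le hx0.le))
    have hM := sum_smoothPart_eq_le A hq0 x ζ
    have hS := sifted_subsequence_le hFL' hCF A hK hq0 hω (hflat q hq0) hA0 hxθ le_rfl
    have hflat' : (∑ e ∈ q.divisors, (μ e : ℝ) * A.density (q * e)) ≤ G q :=
      sumMoebius_le_sumAbsMoebius A.density hg0 (Nat.one_le_iff_ne_zero.mpr hq0)
    have hM0 : 0 ≤ ∑ n ∈ (Ioc 0 ⌊x⌋₊).filter (fun n : ℕ => smoothPart ⌈ζ⌉₊ n = q), A.a n :=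
      Finset.sum_nonneg fun n _ => A.a_nonneg n
    calc generalizedVonMangoldt c q * ∑ n ∈ (Ioc 0 ⌊x⌋₊).filter (fun n : ℕ => smoothPart ⌈ζ⌉₊ n = q), A.a n
        ≤ generalizedVonMangoldt c q *
            ((1 + CF) * ((∑ e ∈ q.divisors, (μ e : ℝ) * A.density (q * e)) * A.size x) *
              ((2 * K) ^ k * V) + RR q) := mul_le_mul_of_nonneg_left (hM.trans hS) hΛ0
      _ = (1 + CF) * (2 * K) ^ k * V * A.size x *
            ((∑ e ∈ q.divisors, (μ e : ℝ) * A.density (q * e)) * generalizedVonMangoldt c q) +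
            generalizedVonMangoldt c q * RR q := by ring
      _ ≤ (1 + CF) * (2 * K) ^ k * V * A.size x * (G q * generalizedVonMangoldt c q) + L ^ c * RR q :=
          add_le_add (mul_le_mul_of_nonneg_left (mul_le_mul_of_nonneg_right hflat' hΛ0) hfac0)
            (mul_le_mul_of_nonneg_right hΛL (hRR0 q))
  refine (Finset.sum_le_sum hper).trans ?_
  rw [Finset.sum_add_distrib, ← Finset.mul_sum, ← Finset.mul_sum]
  refine add_le_add (mul_le_mul_of_nonneg_left ?_ hfac0) le_rfl
  exact Finset.sum_le_sum_of_subset_of_nonneg (Finset.filter_subset _ _) fun q hq _ => hGΛ0 q hq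

end BombieriSieve

end Literature.NumberTheory.Sieve

namespace Literature.NumberTheory.Sieve

namespace BombieriSieve

open Finset ArithmeticFunction Filter Asymptotics
open scoped ArithmeticFunction.Moebius ArithmeticFunction.vonMangoldt Topology

/-! ### Assembly: the `Σ₀`-bound for `z ≤ x^{1/(8k)}` -/

/-- `log₂ X ≤ 1 + 2 log x` for `X ≤ 2x`, `x ≥ 1` (natural logarithm on the right). [folklore] -/
theorem natLog_two_le {X : ℕ} {x : ℝ} (hx : 1 ≤ x) (hX : (X : ℝ) ≤ 2 * x) :
    (Nat.log 2 X : ℝ) ≤ 1 + 2 * Real.log x := by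
  rcases Nat.eq_zero_or_pos X with rfl | hX0
  · simp only [Nat.log_zero_right, Nat.cast_zero]
    linarith [Real.log_nonneg hx]
  have h1 : (Nat.log 2 X : ℝ) ≤ Real.logb 2 X := Real.natLog_le_logb X 2
  have hlog2 : (1 / 2 : ℝ) < Real.log 2 := by
    have := Real.log_two_gt_d9; linarith
  have h2 : Real.logb 2 X ≤ 1 + 2 * Real.log x := by
    rw [Real.logb, div_le_iff₀ (by linarith)]
    have hX1 : (0 : ℝ) < X := by exact_mod_cast hX0
    calc Real.log X ≤ Real.log (2 * x) := Real.log_le_log hX1 hX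
      _ = Real.log 2 + Real.log x := Real.log_mul two_ne_zero (by linarith)
      _ ≤ (1 + 2 * Real.log x) * Real.log 2 := by
          nlinarith [Real.log_nonneg hx, Real.log_le_sub_one_of_pos two_pos]
  exact h1.trans h2

set_option maxHeartbeats 1600000 in
/-- **[FriedlanderIwaniecPisa1978] Lemma 10 for small `z`** (the `Σ₀`-estimate of Bombieri's
Lemmata 1–2 [BombieriAsymptoticSieve1976], in the range `2 ≤ z ≤ x^{1/(8k)}` which is the one
needed for Theorem 1, where `z = x^{ε^{4/3}}`): for a Bombieri sequence and `k ≥ 2` there is `C`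
such that for every `δ > 0`, for all large `x` and all `2 ≤ z ≤ x^{1/(8k)}`,
`Σ₀ ≤ C A(x)(log x)^{k−2} log z + δ A(x)(log x)^{k−1}`.
Proof (a fixed-`k` version of [FriedlanderIwaniecPisa1978] §6, proof of Lemma 24, using only
(A₁), (A₂), (A₅) and the fundamental lemma): regroup `Σ₀` by the `x^{1/(8k)}`-smooth part `q`
(`sigma0_le_sum_smoothPart`), split `q ≤ √x` / `q > √x`; the large `q` are negligible by the
window lemma (`sum_bad_le`), the small `q` are sifted (`sum_good_le`: the fundamental lemma for
`C_q`, [FriedlanderIwaniecPisa1978] Lemma 19), their main terms are summed by peeling the least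
prime (`sum_smooth_weight_generalizedVonMangoldt_le`, which produces the factor `log z`, while
`V(x^{1/(8k)}) ≪ 1/log x` produces the saving), and their remainders are controlled by (A₂)
through the representation count `sum_good_remainders_le`. In the degenerate case `A ≡ 0`,
`Σ₀ = 0`. [cite: FriedlanderIwaniecPisa1978, Lemma 10] [cite: BombieriAsymptoticSieve1976, Lemmata 1-2] -/
theorem FI1978_lemma10_small (A : SieveSequence) (hA : A.IsBombieriSequence) {k : ℕ} (hk : 2 ≤ k) :
    ∃ C : ℝ, ∀ δ : ℝ, 0 < δ → ∀ᶠ x : ℝ in atTop, ∀ z : ℝ, 2 ≤ z → z ≤ x ^ ((8 * k : ℝ)⁻¹) →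
      sigma0 A k x z ≤
        C * A.size x * Real.log x ^ (k - 2) * Real.log z +
          δ * A.size x * Real.log x ^ (k - 1) := by
  have hsize := hA.1
  have hA0 : ∀ x, 0 ≤ A.size x := SieveSequence.size_nonneg_of_size_eq hsize
  have hk1 : 1 ≤ k := by omega
  set θ : ℝ := (8 * k : ℝ)⁻¹ with hθ
  have hk0 : (0 : ℝ) < k := by exact_mod_cast (show 0 < k by omega)
  have hθ0 : 0 < θ := by rw [hθ]; positivity
  have hθ16 : θ ≤ 1 / 16 := by
    rw [hθ]
    have hk2 : (2 : ℝ) ≤ k := by exact_mod_cast hk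
    rw [inv_le_comm₀ (by positivity) (by norm_num)]
    norm_num
    linarith
  have hAsum : ∀ x : ℝ, ∑ n ∈ Ioc 0 ⌊x⌋₊, A.a n = A.size x := fun x => by
    rw [hsize x, SieveSequence.congrSum, Finset.filter_true_of_mem (fun n _ => one_dvd n)]
  -- degenerate case
  by_cases hdeg : ∀ x, A.size x = 0
  · refine ⟨0, fun δ hδ => Filter.Eventually.of_forall fun x z _ _ => ?_⟩
    have ha : ∀ n ∈ Ioc 0 ⌊x⌋₊, A.a n = 0 :=
      (Finset.sum_eq_zero_iff_of_nonneg fun n _ => A.a_nonneg n).mp ((hAsum x).trans (hdeg x))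
    have hs : sigma0 A k x z = 0 := by
      rw [sigma0]
      exact Finset.sum_eq_zero fun n hn => by rw [ha n (Finset.mem_filter.mp hn).1, mul_zero]
    rw [hs, hdeg x]
    simp
  -- non-degenerate: `g ≥ 0`, `g♭ ≥ 0`
  have hpos : ∃ x₀, 0 < A.size x₀ := by
    obtain ⟨x₀, hx₀⟩ := not_forall.mp hdeg
    exact ⟨x₀, lt_of_le_of_ne (hA0 x₀) (Ne.symm hx₀)⟩
  have hg : ∀ d : ℕ, 1 ≤ d → 0 ≤ A.density d :=
    (density_nonneg_or_size_eq_zero A hA).resolve_right fun h => by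
      obtain ⟨x₀, hx₀⟩ := hpos; exact hx₀.ne' (h x₀)
  have hg0' : ∀ n : ℕ, 0 ≤ A.density n := fun n => by
    rcases Nat.eq_zero_or_pos n with rfl | hn
    · rw [ArithmeticFunction.map_zero]
    · exact hg n hn
  have hflat : ∀ q : ℕ, q ≠ 0 → 0 ≤ ∑ e ∈ q.divisors, (μ e : ℝ) * A.density (q * e) :=
    fun q hq => sumMoebius_density_nonneg A hA hpos hq
  -- constants
  obtain ⟨K, hK⟩ := hasSieveDimension A hA hg
  have hK1 : 1 ≤ K := hK.one_le
  obtain ⟨CF, hCF0, hFL'⟩ := SieveSequence.fundamental_lemma_uniform_holds 1 K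
  obtain ⟨H₇, -, -, η₇, -, C₇, h7⟩ := FI1978_lemma7_rat A hA
  set C₇' := max C₇ 0 with hC₇'
  have hC₇'0 : 0 ≤ C₇' := le_max_right _ _
  obtain ⟨CE, hCE0, hE⟩ := primePow_weight_sum_le A hA.2.1 hA.2.2.2.2.2 hg k
  obtain ⟨DW, hDW0, hDW⟩ := sum_smooth_mul_generalizedVonMangoldt_bound k hCE0
  -- the weight `G` and the smooth-sum bound for it
  set G : ℕ → ℝ := fun q => ∑ e ∈ q.divisors, |(μ e : ℝ)| * A.density (q * e) with hGdef
  have hG0 : ∀ m, 0 ≤ G m := fun m => Finset.sum_nonneg fun e _ => mul_nonneg (abs_nonneg _) (hg0' _)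
  have hG1 : G 1 ≤ 1 := by
    simp only [hGdef, Nat.divisors_one, Finset.sum_singleton, ArithmeticFunction.moebius_apply_one,
      Int.cast_one, abs_one, one_mul, mul_one, A.density_mult.map_one]
    exact le_rfl
  have hW0 : ∀ p a : ℕ, 0 ≤ A.density (p ^ a) + A.density (p ^ (a + 1)) :=
    fun p a => add_nonneg (hg0' _) (hg0' _)
  have hGmul : ∀ p a m : ℕ, p.Prime → 1 ≤ a → ¬ p ∣ m →
      G (p ^ a * m) ≤ (A.density (p ^ a) + A.density (p ^ (a + 1))) * G m :=
    fun p a m hp ha hpm => le_of_eq (sumAbsMoebius_primePow_mul A.density A.density_mult hp ha hpm)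
  have hD : ∀ P X : ℕ, 2 ≤ P → ∀ j, j ≤ k →
      ∑ m ∈ Nat.smoothNumbersUpTo X P, G m * generalizedVonMangoldt j m ≤ DW * Real.log P ^ j :=
    fun P X hP j hj => hDW hG0 hG1 hW0 hGmul P X hP (fun c h1 h2 => hE P X c hP h1 h2) j hj
  -- (A₁) with `ε = 1/4`
  obtain ⟨C₁, hC₁⟩ := hA.2.1.1 (1 / 4) (by norm_num)
  have hC₁' : ∀ d : ℕ, 1 ≤ d → A.density d ≤ C₁ * ((d : ℝ) ^ (3 / 4 : ℝ))⁻¹ := by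
    intro d hd
    have h := (le_abs_self _).trans (hC₁ d hd)
    rwa [show (-1 + 1 / 4 : ℝ) = -(3 / 4) by norm_num, Real.rpow_neg (Nat.cast_nonneg d)] at h
  have hC₁0 : 0 ≤ C₁ := by
    have := (abs_nonneg _).trans (hC₁ 1 le_rfl)
    simpa using this
  -- the main constant
  set Cc : ℝ := 2 ^ k * ((1 + CF) * (2 * K) ^ k * (C₇' / θ)) * (2 ^ k * CE * DW * 2) with hCc
  have hCc0 : 0 ≤ Cc := by positivity
  refine ⟨(k + 1) * Cc, fun δ hδ => ?_⟩
  -- (A₂) twice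
  obtain ⟨C₂, hC₂⟩ := hA.2.2.1 (1 / 4) (by norm_num) ((3 * k + 4 : ℕ) : ℝ) (by positivity)
  obtain ⟨C₂', hC₂'⟩ := hA.2.2.1 (1 / 2) (by norm_num) ((k + 2 : ℕ) : ℝ) (by positivity)
  set C₂p := max C₂ 0 with hC₂p
  set C₂p' := max C₂' 0 with hC₂p'
  set Ks : ℝ := (32 : ℝ) ^ k * C₂p + 2 ^ k * C₂p' + 2 ^ (k + 3) * C₁ with hKs
  have hKs0 : 0 ≤ Ks := by positivity
  -- smallness of `1/log x + (log x)² x^{−θ/2}`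
  have hε : Tendsto (fun x : ℝ => (Real.log x)⁻¹ + Real.log x ^ 2 * x ^ (-(θ / 2))) atTop (𝓝 0) := by
    have h1 : Tendsto (fun x : ℝ => (Real.log x)⁻¹) atTop (𝓝 0) :=
      Real.tendsto_log_atTop.inv_tendsto_atTop
    have h2 : Tendsto (fun x : ℝ => Real.log x ^ 2 * x ^ (-(θ / 2))) atTop (𝓝 0) := by
      have hlo := (isLittleO_log_rpow_rpow_atTop 2 (by positivity : 0 < θ / 2)).tendsto_div_nhds_zero
      refine hlo.congr' ?_
      filter_upwards [eventually_gt_atTop (0 : ℝ)] with x hx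
      rw [Real.rpow_neg hx.le, div_eq_mul_inv, Real.rpow_two]
    simpa using h1.add h2
  set η : ℝ := δ / ((k + 1) * (Ks + 1)) with hη
  have hη0 : 0 < η := by rw [hη]; positivity
  have hxθ2 : ∀ᶠ x : ℝ in atTop, 2 ≤ x ^ θ := (tendsto_rpow_atTop hθ0).eventually_ge_atTop 2
  filter_upwards [hC₂, hC₂', (tendsto_order.1 hε).2 η hη0, hxθ2, eventually_ge_atTop (4 : ℝ)]
    with x hx2 hx2' hεx hxθ hx4
  intro z hz hzx
  -- notation and elementary facts at this `x`
  have hx0 : 0 < x := by linarith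
  have hx1 : 1 < x := by linarith
  set L := Real.log x with hL
  set N := ⌊x⌋₊ with hN
  set B := ⌈x ^ θ⌉₊ with hB
  set Pz := ⌈z⌉₊ with hPz
  set S := A.size x with hS
  have hS0 : 0 ≤ S := hA0 x
  have hL1 : 1 ≤ L := by
    rw [hL, ← Real.log_exp 1]
    exact Real.log_le_log (Real.exp_pos 1) (by linarith [Real.exp_one_lt_d9])
  have hL0 : 0 < L := by linarith
  have hz0 : 0 < z := by linarith
  have hz1 : 1 < z := by linarith
  have hlogz0 : 0 < Real.log z := Real.log_pos hz1
  have hzx' : z ≤ x := hzx.trans ((Real.rpow_le_rpow_of_exponent_le hx1.le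
    (show θ ≤ 1 by linarith)).trans (Real.rpow_one x).le)
  have hlogzL : Real.log z ≤ L := Real.log_le_log hz0 hzx'
  have hPz2 : 2 ≤ Pz := by
    have h : ⌈(2 : ℝ)⌉₊ ≤ ⌈z⌉₊ := Nat.ceil_mono hz
    rwa [Nat.ceil_ofNat] at h
  have hPzB : Pz ≤ B := Nat.ceil_mono hzx
  have hB2 : 2 ≤ B := hPz2.trans hPzB
  have hlogPz : Real.log Pz ≤ 2 * Real.log z := by
    have h1 : (Pz : ℝ) < z + 1 := Nat.ceil_lt_add_one hz0.le
    have h2 : z + 1 ≤ z ^ 2 := by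
      nlinarith only [hz, mul_nonneg (sub_nonneg.mpr hz) (show (0 : ℝ) ≤ z + 1 by linarith only [hz])]
    calc Real.log Pz ≤ Real.log (z ^ 2) :=
          Real.log_le_log (by exact_mod_cast (show 0 < Pz by omega)) (by linarith only [h1, h2])
      _ = 2 * Real.log z := by rw [Real.log_pow]; norm_num
  have hxθle : x ^ θ ≤ Real.sqrt x := by
    rw [Real.sqrt_eq_rpow]
    exact Real.rpow_le_rpow_of_exponent_le hx1.le (by linarith only [hθ16])
  have hsqrt2 : 2 ≤ Real.sqrt x := by
    rw [show (2 : ℝ) = Real.sqrt 4 by rw [show (4 : ℝ) = 2 ^ 2 by norm_num, Real.sqrt_sq zero_le_two]]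
    exact Real.sqrt_le_sqrt hx4
  have hsqrtx : Real.sqrt x + 1 ≤ x := by
    have hsx : Real.sqrt x * Real.sqrt x = x := Real.mul_self_sqrt hx0.le
    have h3 : 2 * 1 ≤ Real.sqrt x * (Real.sqrt x - 1) :=
      mul_le_mul hsqrt2 (by linarith only [hsqrt2]) zero_le_one (Real.sqrt_nonneg x)
    nlinarith only [hsx, h3, hsqrt2]
  have hBx : (B : ℝ) ≤ x := by
    have h1 : (B : ℝ) < x ^ θ + 1 := Nat.ceil_lt_add_one (Real.rpow_nonneg hx0.le _)
    linarith only [h1, hxθle, hsqrtx]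
  have hB0 : (0 : ℝ) < B := by exact_mod_cast (show 0 < B by omega)
  have hlogB : Real.log B ≤ L := Real.log_le_log hB0 hBx
  have hlogB0 : 0 ≤ Real.log B := Real.log_natCast_nonneg B
  have hBle : (B : ℝ) ≤ 2 * x ^ θ := by
    have h1 : (B : ℝ) < x ^ θ + 1 := Nat.ceil_lt_add_one (Real.rpow_nonneg hx0.le _)
    linarith only [h1, hxθ]
  -- `V(x^θ) ≤ C₇'/(θ L)`
  set V := A.densityProduct (primesProdBelow (x ^ θ)) with hV
  have hlogζ : Real.log (x ^ θ) = θ * L := Real.log_rpow hx0 θ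
  have hV0 : 0 ≤ V := by
    rw [hV, SieveSequence.densityProduct, primeFactors_primesProdBelow]
    exact Finset.prod_nonneg fun p hp =>
      sub_nonneg.mpr (hK.1 p (Nat.prime_of_mem_primesBelow hp)).2.le
  have hVle : V ≤ C₇' / (θ * L) := by
    refine ((h7 (x ^ θ) hxθ).2.trans ?_)
    rw [hlogζ]
    exact div_le_div_of_nonneg_right (le_max_left _ _) (by positivity)
  -- the index sets
  set Qset := (Nat.smoothNumbersUpTo N B).filter (fun q : ℕ => q ≠ 1 ∧ Nat.minFac q < Pz) with hQset
  have hQmem : ∀ q ∈ Qset, q ≠ 0 ∧ q ≤ N ∧ q ∈ Nat.smoothNumbers B ∧ smoothPart B q = q := by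
    intro q hq
    obtain ⟨hq', -, -⟩ := Finset.mem_filter.mp hq
    obtain ⟨hqN, hsm⟩ := Nat.mem_smoothNumbersUpTo.mp hq'
    refine ⟨Nat.ne_zero_of_mem_smoothNumbers hsm, hqN, hsm, ?_⟩
    have := smoothPart_mul_eq (B := B) (q := q) (r := 1) hsm one_ne_zero
      (fun p hp _ h => hp.one_lt.ne' (Nat.dvd_one.mp h))
    rwa [mul_one] at this
  have hQset' : ∀ q ∈ Qset, q ≠ 0 ∧ q ≤ ⌊x⌋₊ := fun q hq => ⟨(hQmem q hq).1, (hQmem q hq).2.1⟩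
  set M : ℕ → ℝ := fun q => ∑ n ∈ (Ioc 0 N).filter (fun n : ℕ => smoothPart B n = q), A.a n with hM
  have hM0 : ∀ q, 0 ≤ M q := fun q => Finset.sum_nonneg fun n _ => A.a_nonneg n
  -- Step 0: regroup `Σ₀`
  have h0 := sigma0_le_sum_smoothPart A k (B := B) hx1.le hPzB
  rw [← hN] at h0
  -- the two (A₂)-bounds at this `x`
  have hA2a : ∑ m ∈ Finset.Ico 1 ⌈x ^ (1 - 1 / 4 : ℝ)⌉₊, |A.remainder m x| ≤ C₂p * S / L ^ (3 * k + 4) := by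
    have h := hx2 (fun _ => x) fun _ => le_rfl
    rw [Real.rpow_natCast] at h
    exact h.trans (div_le_div_of_nonneg_right (mul_le_mul_of_nonneg_right (le_max_left _ _) hS0)
      (by positivity))
  have hA2b : ∑ m ∈ Finset.Ico 1 ⌈x ^ (1 - 1 / 2 : ℝ)⌉₊, |A.remainder m x| ≤ C₂p' * S / L ^ (k + 2) := by
    have h := hx2' (fun _ => x) fun _ => le_rfl
    rw [Real.rpow_natCast] at h
    exact h.trans (div_le_div_of_nonneg_right (mul_le_mul_of_nonneg_right (le_max_left _ _) hS0)
      (by positivity))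
  -- the multiplicity factor `≤ 16^k L^{2k}` and the window count `≤ 6 L x^θ`
  have hMult : ((((Nat.log 2 ⌈x ^ (1 - 1 / 4 : ℝ)⌉₊ + 1) ^ k) ^ 2 : ℕ) : ℝ) ≤ (4 : ℝ) ^ (2 * k) * L ^ (2 * k) := by
    have hX : ((⌈x ^ (1 - 1 / 4 : ℝ)⌉₊ : ℕ) : ℝ) ≤ 2 * x := by
      have h1 : ((⌈x ^ (1 - 1 / 4 : ℝ)⌉₊ : ℕ) : ℝ) < x ^ (1 - 1 / 4 : ℝ) + 1 :=
        Nat.ceil_lt_add_one (Real.rpow_nonneg hx0.le _)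
      have h2 : x ^ (1 - 1 / 4 : ℝ) ≤ x := by
        calc x ^ (1 - 1 / 4 : ℝ) ≤ x ^ (1 : ℝ) := Real.rpow_le_rpow_of_exponent_le hx1.le (by norm_num)
          _ = x := Real.rpow_one x
      linarith only [h1, h2, hx4]
    have hlog : ((Nat.log 2 ⌈x ^ (1 - 1 / 4 : ℝ)⌉₊ : ℕ) : ℝ) ≤ 1 + 2 * L := natLog_two_le hx1.le hX
    have h4 : ((Nat.log 2 ⌈x ^ (1 - 1 / 4 : ℝ)⌉₊ : ℕ) : ℝ) + 1 ≤ 4 * L := by linarith only [hlog, hL1]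
    push_cast
    calc ((((Nat.log 2 ⌈x ^ (1 - 1 / 4 : ℝ)⌉₊ : ℕ) : ℝ) + 1) ^ k) ^ 2 ≤ ((4 * L) ^ k) ^ 2 := by
          gcongr
      _ = (4 : ℝ) ^ (2 * k) * L ^ (2 * k) := by
          rw [← pow_mul, mul_pow, mul_comm k 2]
  have hWW : (((Nat.primesBelow B ×ˢ Finset.Icc 2 (Nat.log 2 N)).card : ℕ) : ℝ) ≤ 6 * L * x ^ θ := by
    rw [Finset.card_product, Nat.card_Icc]
    have h1 : ((Nat.primesBelow B).card : ℝ) ≤ B := by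
      exact_mod_cast (Finset.card_filter_le _ _).trans (Finset.card_range B).le
    have h2 : ((Nat.log 2 N + 1 - 2 : ℕ) : ℝ) ≤ 3 * L := by
      have hN2 : ((N : ℕ) : ℝ) ≤ 2 * x := (Nat.floor_le hx0.le).trans (by linarith only [hx4])
      have h5 : ((Nat.log 2 N : ℕ) : ℝ) ≤ 1 + 2 * L := natLog_two_le hx1.le hN2
      have h3 : ((Nat.log 2 N + 1 - 2 : ℕ) : ℝ) ≤ Nat.log 2 N := by
        exact_mod_cast (show Nat.log 2 N + 1 - 2 ≤ Nat.log 2 N by omega)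
      linarith only [h5, h3, hL1]
    push_cast
    calc ((Nat.primesBelow B).card : ℝ) * ((Nat.log 2 N + 1 - 2 : ℕ) : ℝ) ≤ B * (3 * L) :=
          mul_le_mul h1 h2 (Nat.cast_nonneg _) (Nat.cast_nonneg _)
      _ ≤ (2 * x ^ θ) * (3 * L) := mul_le_mul_of_nonneg_right hBle (by positivity)
      _ = 6 * L * x ^ θ := by ring
  obtain ⟨ε, hεdef⟩ : ∃ ε : ℝ, ε = L⁻¹ + L ^ 2 * x ^ (-(θ / 2)) := ⟨_, rfl⟩
  have hxθ2' : 0 ≤ x ^ (-(θ / 2)) := Real.rpow_nonneg hx0.le _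
  have hε0 : 0 ≤ ε := by rw [hεdef]; positivity
  have hεL : L⁻¹ ≤ ε := by rw [hεdef]; linarith [mul_nonneg (sq_nonneg L) hxθ2']
  have hεX : L ^ 2 * x ^ (-(θ / 2)) ≤ ε := by rw [hεdef]; linarith [inv_nonneg.mpr hL0.le]
  have hεη : ε ≤ η := by rw [hεdef]; exact hεx.le
  -- the per-`c` bound
  have hper : ∀ c ∈ Finset.range (k + 1), (k.choose c : ℝ) * L ^ (k - c) *
      ∑ q ∈ Qset, generalizedVonMangoldt c q * M q ≤
      Cc * S * L ^ (k - 2) * Real.log z + Ks * ε * (S * L ^ (k - 1)) := by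
    intro c hc
    have hck : c ≤ k := Nat.lt_succ_iff.mp (Finset.mem_range.mp hc)
    have hchoose : (k.choose c : ℝ) ≤ 2 ^ k := by exact_mod_cast Nat.choose_le_two_pow k c
    have hcoef0 : 0 ≤ (k.choose c : ℝ) * L ^ (k - c) := by positivity
    have hcoef : (k.choose c : ℝ) * L ^ (k - c) ≤ 2 ^ k * L ^ (k - c) :=
      mul_le_mul_of_nonneg_right hchoose (by positivity)
    have hRHS0 : 0 ≤ Cc * S * L ^ (k - 2) * Real.log z + Ks * ε * (S * L ^ (k - 1)) := by positivity
    rcases Nat.eq_zero_or_pos c with rfl | hc1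
    · -- `c = 0`: `Λ_0(q) = 0` on `Qset`
      have hz' : ∑ q ∈ Qset, generalizedVonMangoldt 0 q * M q = 0 :=
        Finset.sum_eq_zero fun q hq => by
          rw [generalizedVonMangoldt_zero_apply_of_ne_one (Finset.mem_filter.mp hq).2.1, zero_mul]
      rw [hz', mul_zero]
      exact hRHS0
    -- `1 ≤ c ≤ k`: vanish outside `ω(q) ≤ k`, then split good/bad
    set Qk := Qset.filter (fun q : ℕ => q.primeFactors.card ≤ k) with hQk
    have hvan : ∑ q ∈ Qset, generalizedVonMangoldt c q * M q =
        ∑ q ∈ Qk, generalizedVonMangoldt c q * M q := by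
      rw [hQk]
      symm
      refine Finset.sum_filter_of_ne fun q _ hne => ?_
      by_contra hgt
      rw [not_le] at hgt
      exact hne (by rw [generalizedVonMangoldt_eq_zero_of_lt_card_primeFactors
        (lt_of_le_of_lt hck hgt), zero_mul])
    have hsplit : ∑ q ∈ Qk, generalizedVonMangoldt c q * M q =
        ∑ q ∈ Qk.filter (fun q : ℕ => (q : ℝ) ≤ Real.sqrt x), generalizedVonMangoldt c q * M q +
        ∑ q ∈ Qk.filter (fun q : ℕ => ¬ (q : ℝ) ≤ Real.sqrt x), generalizedVonMangoldt c q * M q :=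
      (Finset.sum_filter_add_sum_filter_not _ _ _).symm
    -- GOOD
    have hgood_set : Qk.filter (fun q : ℕ => (q : ℝ) ≤ Real.sqrt x) =
        Qset.filter (fun q : ℕ => q.primeFactors.card ≤ k ∧ (q : ℝ) ≤ Real.sqrt x) :=
      Finset.filter_filter _ _ _
    have hGd := sum_good_le hFL' hCF0.le A hK hg hflat hx1 hxθ hS0 c Qset hQset'
    have hGsum := sum_smooth_weight_generalizedVonMangoldt_le A.density A.density_mult hg0' k hCE0
      hDW0 hE hD (B := B) (Q := Pz) (X := N) hPz2 hPzB hc1 hck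
    have hRR := sum_good_remainders_le A hk hx1
      (Qset.filter (fun q : ℕ => q.primeFactors.card ≤ k ∧ (q : ℝ) ≤ Real.sqrt x))
      (fun q hq => by
        obtain ⟨hq', hω, hqx⟩ := Finset.mem_filter.mp hq
        exact ⟨hω, hqx, (hQmem q hq').2.2.1⟩)
    -- BAD
    have hbad_set : Qk.filter (fun q : ℕ => ¬ (q : ℝ) ≤ Real.sqrt x) =
        Qset.filter (fun q : ℕ => (smoothPart B q).primeFactors.card ≤ k ∧
          Real.sqrt x < q ∧ smoothPart B q = q) := by
      rw [hQk, Finset.filter_filter]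
      refine Finset.filter_congr fun q hq => ?_
      rw [(hQmem q hq).2.2.2, not_le]
      exact ⟨fun h => ⟨h.1, h.2, rfl⟩, fun h => ⟨h.1, h.2.1⟩⟩
    have hBd := sum_bad_le A hC₁0 hC₁' hk1 hx1 hS0 c Qset (fun q hq => (hQmem q hq).2.1)
    -- combine
    set Fac := (1 + CF) * (2 * K) ^ k * V * S with hFac
    have hFac0 : 0 ≤ Fac := by rw [hFac]; positivity
    have hFacle : Fac ≤ (1 + CF) * (2 * K) ^ k * (C₇' / (θ * L)) * S := by
      rw [hFac]; gcongr
    set Mult : ℝ := ((((Nat.log 2 ⌈x ^ (1 - 1 / 4 : ℝ)⌉₊ + 1) ^ k) ^ 2 : ℕ) : ℝ) with hMultdef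
    set WW : ℝ := (((Nat.primesBelow B ×ˢ Finset.Icc 2 (Nat.log 2 N)).card : ℕ) : ℝ) with hWWdef
    have hsum : ∑ q ∈ Qset, generalizedVonMangoldt c q * M q ≤
        Fac * (2 ^ c * CE * DW * Real.log B ^ (c - 1) * Real.log Pz) +
          L ^ c * (Mult * (C₂p * S / L ^ (3 * k + 4))) +
          L ^ c * (S * (WW * (C₁ * (x ^ (3 / 2 * θ))⁻¹)) + C₂p' * S / L ^ (k + 2)) := by
      rw [hvan, hsplit, hgood_set, hbad_set]
      refine add_le_add ?_ ?_
      · refine hGd.trans (add_le_add (mul_le_mul_of_nonneg_left hGsum hFac0) ?_)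
        refine mul_le_mul_of_nonneg_left (hRR.trans ?_) (by positivity)
        exact mul_le_mul_of_nonneg_left hA2a (Nat.cast_nonneg _)
      · refine hBd.trans (mul_le_mul_of_nonneg_left ?_ (by positivity))
        exact add_le_add le_rfl hA2b
    -- (T1) the main term
    have hLkc : L ^ (k - c) * L ^ (c - 1) = L ^ (k - 2) * L := by
      rw [← pow_add, ← pow_succ]; congr 1; omega
    have hT1 : (k.choose c : ℝ) * L ^ (k - c) * (Fac * (2 ^ c * CE * DW * Real.log B ^ (c - 1) * Real.log Pz)) ≤
        Cc * S * L ^ (k - 2) * Real.log z := by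
      have h2c : (2 : ℝ) ^ c ≤ 2 ^ k := pow_le_pow_right₀ one_le_two hck
      have hlogBc : Real.log B ^ (c - 1) ≤ L ^ (c - 1) := pow_le_pow_left₀ hlogB0 hlogB _
      calc (k.choose c : ℝ) * L ^ (k - c) * (Fac * (2 ^ c * CE * DW * Real.log B ^ (c - 1) * Real.log Pz))
          ≤ (2 ^ k * L ^ (k - c)) * (((1 + CF) * (2 * K) ^ k * (C₇' / (θ * L)) * S) *
              (2 ^ k * CE * DW * L ^ (c - 1) * (2 * Real.log z))) := by
            refine mul_le_mul hcoef (mul_le_mul hFacle ?_ (by positivity) (by positivity))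
              (by positivity) (by positivity)
            gcongr
        _ = Cc * S * Real.log z * (L ^ (k - c) * L ^ (c - 1) / L) := by
            rw [hCc]; field_simp
        _ = Cc * S * L ^ (k - 2) * Real.log z := by
            rw [hLkc, mul_div_assoc, div_self hL0.ne', mul_one]; ring
    -- (T2) the good remainders
    have hLk : L ^ (k - c) * L ^ c = L ^ k := by rw [← pow_add]; congr 1; omega
    have hinvL : ∀ n : ℕ, 1 ≤ n → (L ^ n)⁻¹ ≤ L⁻¹ * L ^ (k - 1) := by
      intro n hn
      have h1 : (L ^ n)⁻¹ ≤ L⁻¹ := by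
        rw [inv_le_inv₀ (by positivity) hL0]
        calc L = L ^ 1 := (pow_one L).symm
          _ ≤ L ^ n := pow_le_pow_right₀ hL1 hn
      calc (L ^ n)⁻¹ ≤ L⁻¹ * 1 := by rw [mul_one]; exact h1
        _ ≤ L⁻¹ * L ^ (k - 1) := mul_le_mul_of_nonneg_left (one_le_pow₀ hL1) (by positivity)
    have hT2 : (k.choose c : ℝ) * L ^ (k - c) * (L ^ c * (Mult * (C₂p * S / L ^ (3 * k + 4)))) ≤
        (32 : ℝ) ^ k * C₂p * L⁻¹ * (S * L ^ (k - 1)) := by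
      have hC₂p0 : 0 ≤ C₂p := le_max_right _ _
      have hMult0 : 0 ≤ Mult := Nat.cast_nonneg _
      calc (k.choose c : ℝ) * L ^ (k - c) * (L ^ c * (Mult * (C₂p * S / L ^ (3 * k + 4))))
          ≤ (2 ^ k * L ^ (k - c)) * (L ^ c * ((4 : ℝ) ^ (2 * k) * L ^ (2 * k) * (C₂p * S / L ^ (3 * k + 4)))) := by
            refine mul_le_mul hcoef (mul_le_mul_of_nonneg_left (mul_le_mul_of_nonneg_right hMult
              (by positivity)) (by positivity)) (by positivity) (by positivity)
        _ = (32 : ℝ) ^ k * C₂p * S * ((L ^ (k - c) * L ^ c) * L ^ (2 * k) / L ^ (3 * k + 4)) := by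
            rw [show (32 : ℝ) ^ k = 2 ^ k * 4 ^ (2 * k) by
              rw [pow_mul, show ((4 : ℝ) ^ 2) = 16 by norm_num, ← mul_pow]; norm_num]; ring
        _ = (32 : ℝ) ^ k * C₂p * S * (L ^ 4)⁻¹ := by
            congr 1
            rw [hLk, ← pow_add, show k + 2 * k = 3 * k by ring, pow_add,
              div_mul_cancel_left₀ (pow_ne_zero _ hL0.ne')]
        _ ≤ (32 : ℝ) ^ k * C₂p * S * (L⁻¹ * L ^ (k - 1)) :=
            mul_le_mul_of_nonneg_left (hinvL 4 (by norm_num)) (by positivity)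
        _ = (32 : ℝ) ^ k * C₂p * L⁻¹ * (S * L ^ (k - 1)) := by ring
    -- (T3) the bad densities
    have hxpow : x ^ θ * (x ^ (3 / 2 * θ))⁻¹ = x ^ (-(θ / 2)) := by
      rw [← Real.rpow_neg hx0.le, ← Real.rpow_add hx0]; ring_nf
    have hLk1 : L ^ k = L ^ (k - 1) * L := by
      rw [← pow_succ]; congr 1; omega
    have hT3 : (k.choose c : ℝ) * L ^ (k - c) * (L ^ c * (S * (WW * (C₁ * (x ^ (3 / 2 * θ))⁻¹)))) ≤
        (2 : ℝ) ^ (k + 3) * C₁ * (L ^ 2 * x ^ (-(θ / 2))) * (S * L ^ (k - 1)) := by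
      have hX0 : 0 ≤ (x ^ (3 / 2 * θ))⁻¹ := inv_nonneg.mpr (Real.rpow_nonneg hx0.le _)
      calc (k.choose c : ℝ) * L ^ (k - c) * (L ^ c * (S * (WW * (C₁ * (x ^ (3 / 2 * θ))⁻¹))))
          ≤ (2 ^ k * L ^ (k - c)) * (L ^ c * (S * ((6 * L * x ^ θ) * (C₁ * (x ^ (3 / 2 * θ))⁻¹)))) := by
            refine mul_le_mul hcoef (mul_le_mul_of_nonneg_left (mul_le_mul_of_nonneg_left
              (mul_le_mul_of_nonneg_right hWW (by positivity)) hS0) (by positivity))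
              (by positivity) (by positivity)
        _ = 6 * 2 ^ k * C₁ * S * ((L ^ (k - c) * L ^ c) * L) * (x ^ θ * (x ^ (3 / 2 * θ))⁻¹) := by ring
        _ = 6 * 2 ^ k * C₁ * (L ^ 2 * x ^ (-(θ / 2))) * (S * L ^ (k - 1)) := by
            rw [hLk, hxpow, hLk1]; ring
        _ ≤ (2 : ℝ) ^ (k + 3) * C₁ * (L ^ 2 * x ^ (-(θ / 2))) * (S * L ^ (k - 1)) := by
            rw [pow_add]
            have : (6 : ℝ) * 2 ^ k ≤ 2 ^ k * 2 ^ 3 := by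
              rw [show (2 : ℝ) ^ k * 2 ^ 3 = 8 * 2 ^ k by ring]
              exact mul_le_mul_of_nonneg_right (by norm_num) (by positivity)
            exact mul_le_mul_of_nonneg_right (mul_le_mul_of_nonneg_right
              (mul_le_mul_of_nonneg_right this hC₁0) (by positivity)) (by positivity)
    -- (T4) the bad remainders
    have hT4 : (k.choose c : ℝ) * L ^ (k - c) * (L ^ c * (C₂p' * S / L ^ (k + 2))) ≤
        (2 : ℝ) ^ k * C₂p' * L⁻¹ * (S * L ^ (k - 1)) := by
      have hC₂p'0 : 0 ≤ C₂p' := le_max_right _ _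
      calc (k.choose c : ℝ) * L ^ (k - c) * (L ^ c * (C₂p' * S / L ^ (k + 2)))
          ≤ (2 ^ k * L ^ (k - c)) * (L ^ c * (C₂p' * S / L ^ (k + 2))) :=
            mul_le_mul_of_nonneg_right hcoef (by positivity)
        _ = (2 : ℝ) ^ k * C₂p' * S * ((L ^ (k - c) * L ^ c) / L ^ (k + 2)) := by ring
        _ = (2 : ℝ) ^ k * C₂p' * S * (L ^ 2)⁻¹ := by
            rw [hLk, pow_add, div_mul_cancel_left₀ (pow_ne_zero _ hL0.ne')]
        _ ≤ (2 : ℝ) ^ k * C₂p' * S * (L⁻¹ * L ^ (k - 1)) :=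
            mul_le_mul_of_nonneg_left (hinvL 2 (by norm_num)) (by positivity)
        _ = (2 : ℝ) ^ k * C₂p' * L⁻¹ * (S * L ^ (k - 1)) := by ring
    -- combine
    have hC₂p0 : 0 ≤ C₂p := le_max_right _ _
    have hC₂p'0 : 0 ≤ C₂p' := le_max_right _ _
    have hSL0 : 0 ≤ S * L ^ (k - 1) := by positivity
    calc (k.choose c : ℝ) * L ^ (k - c) * ∑ q ∈ Qset, generalizedVonMangoldt c q * M q
        ≤ (k.choose c : ℝ) * L ^ (k - c) * (Fac * (2 ^ c * CE * DW * Real.log B ^ (c - 1) * Real.log Pz) +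
            L ^ c * (Mult * (C₂p * S / L ^ (3 * k + 4))) +
            L ^ c * (S * (WW * (C₁ * (x ^ (3 / 2 * θ))⁻¹)) + C₂p' * S / L ^ (k + 2))) :=
          mul_le_mul_of_nonneg_left hsum hcoef0
      _ = (k.choose c : ℝ) * L ^ (k - c) * (Fac * (2 ^ c * CE * DW * Real.log B ^ (c - 1) * Real.log Pz)) +
            (k.choose c : ℝ) * L ^ (k - c) * (L ^ c * (Mult * (C₂p * S / L ^ (3 * k + 4)))) +
            ((k.choose c : ℝ) * L ^ (k - c) * (L ^ c * (S * (WW * (C₁ * (x ^ (3 / 2 * θ))⁻¹)))) +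
              (k.choose c : ℝ) * L ^ (k - c) * (L ^ c * (C₂p' * S / L ^ (k + 2)))) := by ring
      _ ≤ Cc * S * L ^ (k - 2) * Real.log z + (32 : ℝ) ^ k * C₂p * L⁻¹ * (S * L ^ (k - 1)) +
            ((2 : ℝ) ^ (k + 3) * C₁ * (L ^ 2 * x ^ (-(θ / 2))) * (S * L ^ (k - 1)) +
              (2 : ℝ) ^ k * C₂p' * L⁻¹ * (S * L ^ (k - 1))) :=
          add_le_add (add_le_add hT1 hT2) (add_le_add hT3 hT4)
      _ ≤ Cc * S * L ^ (k - 2) * Real.log z + (32 : ℝ) ^ k * C₂p * ε * (S * L ^ (k - 1)) +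
            ((2 : ℝ) ^ (k + 3) * C₁ * ε * (S * L ^ (k - 1)) +
              (2 : ℝ) ^ k * C₂p' * ε * (S * L ^ (k - 1))) := by
          gcongr
      _ = Cc * S * L ^ (k - 2) * Real.log z + Ks * ε * (S * L ^ (k - 1)) := by
          rw [hKs]; ring
  -- sum over `c`
  have hcard : (Finset.range (k + 1)).card = k + 1 := Finset.card_range _
  have hsumc := Finset.sum_le_card_nsmul _ _ _ hper
  rw [hcard, nsmul_eq_mul] at hsumc
  refine h0.trans (hsumc.trans ?_)
  -- `(k+1) Ks ε ≤ δ`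
  have hKε : (k + 1 : ℝ) * (Ks * ε) ≤ δ := by
    calc (k + 1 : ℝ) * (Ks * ε) ≤ (k + 1) * (Ks * η) := by gcongr
      _ = δ * (Ks / (Ks + 1)) := by rw [hη]; field_simp
      _ ≤ δ * 1 := mul_le_mul_of_nonneg_left ((div_le_one (by positivity)).mpr
          (le_add_of_nonneg_right zero_le_one)) hδ.le
      _ = δ := mul_one δ
  have hSL0 : 0 ≤ S * L ^ (k - 1) := by positivity
  push_cast
  calc ((k : ℝ) + 1) * (Cc * S * L ^ (k - 2) * Real.log z + Ks * ε * (S * L ^ (k - 1)))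
      = ((k : ℝ) + 1) * Cc * S * L ^ (k - 2) * Real.log z + ((k : ℝ) + 1) * (Ks * ε) * (S * L ^ (k - 1)) := by
        ring
    _ ≤ ((k : ℝ) + 1) * Cc * S * L ^ (k - 2) * Real.log z + δ * (S * L ^ (k - 1)) :=
        add_le_add le_rfl (mul_le_mul_of_nonneg_right hKε hSL0)
    _ = ((k : ℝ) + 1) * Cc * A.size x * Real.log x ^ (k - 2) * Real.log z +
          δ * A.size x * Real.log x ^ (k - 1) := by rw [hS, hL]; ring

end BombieriSieve

end Literature.NumberTheory.Sieve

namespace Literature.NumberTheory.Sieve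

open Filter Finset Asymptotics
open scoped Topology

namespace BombieriSieve

/-- **The three lemmata combined, with Lemma 10 in the small range `z ≤ x^{1/(8k)}`** (a copy of
`BombieriSieve.core` of `BombieriAsymptoticSieve.lean` in which the named fact `FI1978_lemma10` is
replaced by its proved small-range version `FI1978_lemma10_small`, which suffices because
`z = x^{u^{−4}}` with `u → ∞`; [FriedlanderIwaniecPisa1978] pp. 739–740, "Conclusion of
proof of Theorem 1", up to the display `∑_{n ≤ x} a_n Λ_{(k)}(n) = H A(x) F +
O(ε^{1/3} A(x)(log x)^{|k|−1})` for `x > x₀(ε, (k))`). With the running parameter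
`u = ε^{−1/3} → ∞` (`y = x^{1−2u^{−3}}`, `z = x^{u^{−4}}`, `s = u`): given the bounds of
Lemmata 10, 11, 12, for every `ε' > 0`, for all large `u` and then all large `x`,
`|S_k(x) − H A(x) F(x, y, z)| ≤ ε' A(x)(log x)^{k−1}`. Ingredients: `S = Σ₀ + Σ₁ + Σ₂`
(`sum_eq_sigma0_add_sigma1_add_sigma2`); `Σ₀ ≤ (C₁₀⁺ + 1) u^{−4} A L^{k−1}` (`sigma0_arith`);
`|Σ₂| ≤ C₁₁⁺ 2^{k+1} u^{−1} A L^{k−1}` (`sigma2_arith`, using `k ≥ 2`);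
`|Σ₁ − HAF| ≤ C₁₂⁺ (u⁸ e^{−u} + 2u^{−4}) A L^{k−1}` (`sigma1_arith`, using (A₄):
`∫₁^x A(t)dt/t = o(A L)`, and `z^{−η} log x → 0`); and
`(C₁₀⁺ + 1 + 2C₁₂⁺)u^{−4} + C₁₁⁺ 2^{k+1} u^{−1} + C₁₂⁺ u⁸ e^{−u} → 0`.
[cite: FriedlanderIwaniecPisa1978, pp. 739-740 (conclusion of proof of Theorem 1)] -/
theorem core_small
    (h10 : ∀ A : SieveSequence, A.IsBombieriSequence → ∀ k : ℕ, 2 ≤ k →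
      ∃ C : ℝ, ∀ δ : ℝ, 0 < δ → ∀ᶠ x : ℝ in atTop, ∀ z : ℝ, 2 ≤ z → z ≤ x ^ ((8 * k : ℝ)⁻¹) →
        sigma0 A k x z ≤
          C * A.size x * Real.log x ^ (k - 2) * Real.log z + δ * A.size x * Real.log x ^ (k - 1))
    (h11 : FI1978_lemma11) (h12 : FI1978_lemma12)
    {A : SieveSequence} {H : ℝ} (hA : A.IsBombieriSequence) (hH : A.HasDensityConstant H)
    {k : ℕ} (hk : 2 ≤ k) {ε : ℝ} (hε : 0 < ε) :
    ∀ᶠ u : ℝ in atTop, ∀ᶠ x : ℝ in atTop,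
      |(∑ n ∈ Ioc 0 ⌊x⌋₊, generalizedVonMangoldt k n * A.a n) -
          H * A.size x * mainTermF k x (x ^ (1 - 2 * u⁻¹ ^ 3)) (x ^ (u⁻¹ ^ 4))| ≤
        ε * A.size x * Real.log x ^ (k - 1) := by
  obtain ⟨m, rfl⟩ : ∃ m, k = m + 2 := ⟨k - 2, by omega⟩
  have e1 : m + 2 - 1 = m + 1 := by omega
  have e2 : m + 2 - 2 = m := by omega
  obtain ⟨C₀, hC₀⟩ := h10 A hA (m + 2) hk
  obtain ⟨C₂, hC₂⟩ := h11 A hA (m + 2) (by omega)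
  obtain ⟨η, hη, C₁, hC₁⟩ := h12 A H hA hH (m + 2) (by omega)
  simp only [e1, e2] at hC₀ hC₁ ⊢
  set D₀ := max C₀ 0 with hD₀
  set D₁ := max C₁ 0 with hD₁
  set D₂ := max C₂ 0 with hD₂
  -- the function `Ψ(u)` bounding `|S − HAF| / (A L^{k−1})` tends to `0`
  have hΨ : Tendsto (fun u : ℝ => (D₀ + 1 + 2 * D₁) * u⁻¹ ^ 4 + D₂ * 2 ^ (m + 3) * u⁻¹ +
      D₁ * (u ^ 8 * Real.exp (-u))) atTop (𝓝 0) := by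
    have h1 : Tendsto (fun u : ℝ => u⁻¹) atTop (𝓝 0) := tendsto_inv_atTop_zero
    have h2 : Tendsto (fun u : ℝ => u⁻¹ ^ 4) atTop (𝓝 0) := by simpa using h1.pow 4
    have h3 := Real.tendsto_pow_mul_exp_neg_atTop_nhds_zero 8
    simpa using ((h2.const_mul (D₀ + 1 + 2 * D₁)).add (h1.const_mul (D₂ * 2 ^ (m + 3)))).add
      (h3.const_mul D₁)
  filter_upwards [(tendsto_order.1 hΨ).2 ε hε, eventually_ge_atTop (2 : ℝ),
    eventually_ge_atTop ((8 * ((m + 2 : ℕ) : ℝ)))] with u hu hu2 hu8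
  -- from now on `u ≥ 2` is fixed; `v = u⁻¹ ≤ 1/2`
  have hu0 : 0 < u := by linarith
  set v : ℝ := u⁻¹ with hv
  have hv0 : 0 < v := inv_pos.mpr hu0
  have hv1 : v ≤ 1 / 2 := by rw [hv, one_div]; exact (inv_le_inv₀ hu0 two_pos).mpr hu2
  have hvu : v * u = 1 := by rw [hv]; exact inv_mul_cancel₀ hu0.ne'
  -- the three lemmata at this `u`
  have h10' := hC₀ (v ^ 4) (by positivity)
  have h11' := hC₂ (v ^ 3) (by positivity)
  have h12' := hC₁ (v ^ 3) (by positivity) u hu2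
  -- (A₄): `∫₁^x A(t) dt/t ≤ v¹² A(x) log x` eventually
  have hI : ∀ᶠ x : ℝ in atTop,
      ∫ t in (1 : ℝ)..x, A.size t / t ≤ v ^ 12 * (A.size x * Real.log x) := by
    filter_upwards [hA.2.2.2.2.1.1.bound (by positivity : 0 < v ^ 12),
      eventually_ge_atTop (1 : ℝ)] with x hx hx1
    have hA0 : 0 ≤ A.size x := SieveSequence.size_nonneg_of_size_eq hA.size_eq x
    rw [Real.norm_of_nonneg (mul_nonneg hA0 (Real.log_nonneg hx1))] at hx
    exact (le_abs_self _).trans hx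
  -- `z^{−η} log x = x^{−η v⁴} log x ≤ v¹²` eventually
  have hzeta : ∀ᶠ x : ℝ in atTop, x ^ (-(η * v ^ 4)) * Real.log x ≤ v ^ 12 := by
    have hlo :=
      (isLittleO_log_rpow_rpow_atTop 1 (by positivity : 0 < η * v ^ 4)).tendsto_div_nhds_zero
    filter_upwards [(tendsto_order.1 hlo).2 _ (by positivity : 0 < v ^ 12),
      eventually_gt_atTop (0 : ℝ)] with x hx hx0
    rw [Real.rpow_one] at hx
    rw [Real.rpow_neg hx0.le, inv_mul_eq_div]
    exact hx.le
  have hz2 : ∀ᶠ x : ℝ in atTop, 2 ≤ x ^ (v ^ 4) :=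
    (tendsto_rpow_atTop (by positivity : 0 < v ^ 4)).eventually_ge_atTop 2
  filter_upwards [h10', h11', h12', hI, hzeta, hz2, eventually_ge_atTop (2 : ℝ)]
    with x h10x h11x h12x hIx hzx hz2x hx2
  -- notation and elementary facts at this `x`
  have hx0 : 0 < x := by linarith
  have hx1 : 1 < x := by linarith
  obtain ⟨hz14, hzy, hzsy, hyx, hy1, hzsy'⟩ := params hv0 hv1 hvu hx2
  set L := Real.log x with hL
  set S := A.size x with hS
  set y := x ^ (1 - 2 * v ^ 3) with hy
  set z := x ^ (v ^ 4) with hz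
  have hL0 : 0 < L := Real.log_pos hx1
  have hS0 : 0 ≤ S := SieveSequence.size_nonneg_of_size_eq hA.size_eq x
  have hy0 : 0 < y := Real.rpow_pos_of_pos hx0 _
  have hlogz : Real.log z = v ^ 4 * L := Real.log_rpow hx0 _
  have hlogxy : Real.log (x / y) = 2 * v ^ 3 * L := by
    rw [Real.log_div hx0.ne' hy0.ne', hy, Real.log_rpow hx0]; ring
  -- Lemma 10 (small range): Σ₀ ≤ (D₀ + 1) v⁴ · S L^{m+1}; here `z = x^{v⁴} ≤ x^{1/(8k)}`
  have hzθ : z ≤ x ^ ((8 * ((m + 2 : ℕ) : ℝ))⁻¹) := by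
    rw [hz]
    refine Real.rpow_le_rpow_of_exponent_le hx1.le ?_
    have hv1' : v ≤ 1 := by linarith
    have hv4 : v ^ 4 ≤ v := by
      calc v ^ 4 ≤ v ^ 1 := pow_le_pow_of_le_one hv0.le hv1' (by norm_num)
        _ = v := pow_one v
    have hu8' : (0 : ℝ) < 8 * ((m + 2 : ℕ) : ℝ) := by positivity
    have hvu8 : v ≤ (8 * ((m + 2 : ℕ) : ℝ))⁻¹ := by
      rw [hv]; exact (inv_le_inv₀ hu0 hu8').mpr hu8
    exact hv4.trans hvu8
  have B0 : sigma0 A (m + 2) x z ≤ (D₀ + 1) * v ^ 4 * (S * L ^ (m + 1)) := by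
    have h := h10x z hz2x hzθ
    rw [hlogz] at h
    exact sigma0_arith hS0 hL0.le h
  -- Lemma 11: |Σ₂| ≤ D₂ 2^{m+3} v · S L^{m+1}
  have B2 : |sigma2 A (m + 2) x y z| ≤ D₂ * 2 ^ (m + 3) * v * (S * L ^ (m + 1)) := by
    have h := h11x y z hz2x hzy hzsy hyx
    rw [hlogxy, hlogz] at h
    exact sigma2_arith hS0 hL0 hv0 (by linarith) h
  -- Lemma 12: |Σ₁ − HSF| ≤ D₁ (u⁸ e^{−u} + 2 v⁴) · S L^{m+1}
  have B1 : |sigma1 A (m + 2) x y z - H * S * mainTermF (m + 2) x y z| ≤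
      D₁ * (u ^ 8 * Real.exp (-u) + 2 * v ^ 4) * (S * L ^ (m + 1)) := by
    have h := h12x y z hz2x hy1 hzsy'
    have hratio : L / Real.log z = u ^ 4 := by
      rw [hlogz, div_eq_iff (by positivity)]
      have : v ^ 4 * u ^ 4 = 1 := by rw [← mul_pow, hvu, one_pow]
      calc L = L * (v ^ 4 * u ^ 4) := by rw [this, mul_one]
        _ = u ^ 4 * (v ^ 4 * L) := by ring
    have hzη : z ^ (-η) = x ^ (-(η * v ^ 4)) := by
      rw [hz, ← Real.rpow_mul hx0.le]; ring_nf
    rw [hratio, hzη] at h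
    have hint0 : 0 ≤ ∫ t in (1 : ℝ)..x, A.size t / t :=
      intervalIntegral.integral_nonneg hx1.le fun t ht =>
        div_nonneg (SieveSequence.size_nonneg_of_size_eq hA.size_eq t) (by linarith [ht.1])
    exact sigma1_arith hS0 hL0.le (Real.exp_pos _).le hint0 (Real.rpow_nonneg hx0.le _) hvu hIx
      hzx h
  -- combine
  have hsplit := sum_eq_sigma0_add_sigma1_add_sigma2 A (by omega : 0 < m + 2) x y z
  have h0abs : |sigma0 A (m + 2) x z| = sigma0 A (m + 2) x z :=
    abs_of_nonneg (sigma0_nonneg A _ x z)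
  have hW0 : 0 ≤ S * L ^ (m + 1) := by positivity
  calc |(∑ n ∈ Ioc 0 ⌊x⌋₊, generalizedVonMangoldt (m + 2) n * A.a n) -
          H * S * mainTermF (m + 2) x y z|
      = |sigma0 A (m + 2) x z + (sigma1 A (m + 2) x y z - H * S * mainTermF (m + 2) x y z) +
          sigma2 A (m + 2) x y z| := by rw [hsplit]; ring_nf
    _ ≤ |sigma0 A (m + 2) x z| + |sigma1 A (m + 2) x y z - H * S * mainTermF (m + 2) x y z| +
          |sigma2 A (m + 2) x y z| := abs_add_three _ _ _
    _ ≤ (D₀ + 1) * v ^ 4 * (S * L ^ (m + 1)) +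
          D₁ * (u ^ 8 * Real.exp (-u) + 2 * v ^ 4) * (S * L ^ (m + 1)) +
          D₂ * 2 ^ (m + 3) * v * (S * L ^ (m + 1)) := by rw [h0abs]; linarith
    _ = ((D₀ + 1 + 2 * D₁) * v ^ 4 + D₂ * 2 ^ (m + 3) * v + D₁ * (u ^ 8 * Real.exp (-u))) *
          (S * L ^ (m + 1)) := by ring
    _ ≤ ε * (S * L ^ (m + 1)) := mul_le_mul_of_nonneg_right hu.le hW0
    _ = ε * S * L ^ (m + 1) := by ring

end BombieriSieve

end Literature.NumberTheory.Sieve
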